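import Mathlib.LinearAlgebra.Dual.Lemmas
import Literature.NumberTheory.Automorphic.WhittakerModels
import Literature.NumberTheory.Automorphic.ParabolicInduction
import Literature.NumberTheory.Automorphic.TwistedJacquetAdditive
import HarnessLib

/-!
# Supercuspidal representations of `GL_n(F)` are generic (modulo Harish-Chandra's criterion)

This file proves, sorry-free, the theorem of Gelfand–Kazhdan (1975, Thm. 8; Bernstein–Zelevinsky
1977, Theorem 4.4 with §3.5) that an irreducible smooth supercuspidal representation `π` of
`GL_n(F)`, `F` a non-archimedean local field, admits a non-zero Whittaker functional for every
non-trivial continuous `ψ` — the named fact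
`Literature.NumberTheory.Automorphic.isGeneric_of_isSupercuspidal π ψ` of `WhittakerModels` —
*from* the named fact `Literature.NumberTheory.Automorphic.isSupercuspidal_iff_jacquetGL F` of
`ParabolicInduction` (Harish-Chandra's criterion: the matrix coefficients of an irreducible
smooth `π` are compactly supported modulo the centre iff all proper Jacquet modules of `π`
vanish), of which only the forward direction for the maximal parabolics `P_{(t, n-t)}` is used:

* `Literature.NumberTheory.Automorphic.isGeneric_of_isSupercuspidal_of_jacquet :
    isSupercuspidal_iff_jacquetGL F → isGeneric_of_isSupercuspidal π ψ`.

## The printed argument and its formalisation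

Bernstein–Zelevinsky (1977), §3: restrict `π` to the mirabolic `P_n`; the functor
`Φ⁻ = r_{V,θ}` (twisted coinvariants under the last column `V ≅ F^{n-1}` for the character
`θ(v) = ψ(v_{n-1,n})`) and `Ψ⁻ = r_{V,1}` satisfy `0 → Φ⁺Φ⁻ → Id → Ψ⁺Ψ⁻ → 0` (Prop. 3.2 (e)),
so a non-zero representation of `P_n` has `Φ⁻ ≠ 0` or `Ψ⁻ ≠ 0`; the derivatives are
`π^{(k)} = Ψ⁻(Φ⁻)^{k-1}(π)` (§3.5) and for quasicuspidal `π`, `π^{(k)} = 0` for `0 < k < n`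
(Theorem 4.4, Gelfand–Kazhdan), because `π^{(k)}` is a quotient of the Jacquet module of
`P_{(n-k,k)}`. Hence `(Φ⁻)^{n-1}(π) = π_{U_n, ψ_U} ≠ 0`, whose dual is the space of Whittaker
functionals.

Concretely (no category of `P_n`-modules is built): for `0 ≤ k ≤ n - 1` let `N_{>k} ≤ U_n` be
the unipotent matrices supported in the columns of index `> k` (`tailSet n F k`; `N_{>0} = U_n`,
`N_{>n-1} = 1`) and `Θ_{T_k}(g) = ψ(∑_{r ≥ k} g_{r,r+1})` its generic character
(`charOf ψ (tailWt n F k)`), and put `W_k = V(N_{>k}, Θ_{T_k}) = ⟨π(m)v - Θ(m)v⟩`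
(`derivKer`; the kernel of `V → (Φ⁻)^{n-1-k}(π)`). We show `W_k ≠ V` for all `k` by downward
induction (`derivKer_ne_top`): `W_k = 0` for `k ≥ n - 1`; and if `W_t ≠ V` (`1 ≤ t ≤ n-1`) then
(`derivKer_pred_ne_top`)
1. *coordinate descent in the column `t`* (`exists_stepKer_self_ne_top`): applying the rank-one
   non-vanishing theorem `TwistedJacquet.exists_sup_twistedSpan_ne_top` (the formal content of
   Prop. 3.2 (e)) successively to the root subgroups `x ↦ 1 + x E_{i,t}`, `i < t`, acting on
   `V / (V(C_t^{<i}, Θ_a) + W_t)`, one finds `a ∈ F^t` with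
   `S_a = V(C_t, Θ_{X_t(a)+T_t}) + W_t ≠ V`, where `C_t = {1 + X_t(x)}` is the column group and
   `Θ_{X_t(a)+T_t}(1 + X_t(x)) = ψ(∑ a_r x_r)`;
2. `a ≠ 0`: for `a = 0`, `S_0 ⊇ V(U_{(t,n-t)}, 1) = V` by the vanishing of the Jacquet module of
   the maximal parabolic (`isSupercuspidal_iff_jacquetGL`), since `U_{(t,n-t)} ⊆ C_t N_{>t}` and
   `Θ` is trivial on it (`twistedKer_tailSet_pred_le`, coinvariants in stages);
3. *transitivity of `GL_t` on non-zero rows* (`exists_topLeft_row_eq`, a product of two row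
   shears): some `g = diag(g₀, 1)` has `e_{t-1} g₀ = a`, and conjugation by `g` carries `S_a` to
   `S_{e_{t-1}} = V(C_t, Θ_{T_{t-1}}|) + W_t ⊇ W_{t-1}` (`T_{t-1} = X_t(e_{t-1}) + T_t`,
   `tailWt_pred`), so `W_{t-1} ≠ V`.
Finally a non-zero linear form vanishing on `W_0 = V(U_n, ψ_U)` is a Whittaker functional.

## Contents

* `Representation.twistedKer ρ H χ` (any subset `H ⊆ G`, any `χ : G → k`) with monotonicity,
  "coinvariants in stages" `twistedKer_le_sup_of_mul`, transport `map_twistedKer_le`, and the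
  comparison `coinvariantsKer_restrictUnipotentGL_le` with Mathlib's `Coinvariants.ker`.
* Matrix bookkeeping in `GL_n(R)` (namespace `WhittakerSupercuspidal`): the column matrices
  `colMat`/`colElem` (`c_t(x) = 1 + X_t(x)`, additive in `x`), the sets `tailSet`, `colPartSet`,
  the factorisations `factor_colPartSet_succ`, `colElem_inv_mul_mem_tailSet`, conjugation of
  `N_{>t}` by root elements (`conj_tail_*`) and by block matrices `diag(g₀,1)` (`IsTopLeft`,
  `topLeft_conj_*`), row shears `rowShear` and `exists_topLeft_row_eq`.
* The characters `charOf ψ B` attached to weight matrices, `tailWt`, `charOf_colElem`,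
  `charOf_colElem_mul_tail`, `tailWt_pred`, `whittakerCharFun_eq_charOf`; the two-block
  labellings `twoBlock` and the entries of `unipotentRadicalGL F (twoBlock t)`.
* The induction: `derivKer`, `stepKer`, `exists_stepKer_succ_ne_top`, `derivKer_pred_ne_top`,
  `derivKer_ne_top`, and `isGeneric_of_isSupercuspidal_of_jacquet`.

All declarations are definitions with bodies or proved theorems; no named fact is introduced.

## References

* I. M. Gelfand, D. A. Kazhdan, *Representations of the group `GL(n, K)` where `K` is a local
  field*, in: Lie groups and their representations (Budapest 1971), Halsted (1975), 95–118,
  Thm. 8 (`GelfandKazhdan1975`; not held).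
* I. N. Bernstein, A. V. Zelevinsky, *Induced representations of reductive `p`-adic groups I*,
  Ann. Sci. ÉNS (4) 10 (1977), 441–472, §3.1–3.5, Theorem 4.4 (`BernsteinZelevinskyASENS1977`;
  Numdam, read).
* D. Bump, *Automorphic forms and representations* (1997), §4.4 (PDF pp. 455–465) (`Bump1997`).
-/

open Matrix

namespace Literature.NumberTheory.Automorphic

namespace WhittakerSupercuspidal

section Matrices

variable {R : Type*} [CommRing R] {n : ℕ}

/-! #### Two multiplication lemmas -/

/-- If row `r` of `M` is the `r`-th unit row then row `r` of `M N` is row `r` of `N`. [folklore] -/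
lemma mul_apply_of_row_eq (M N : Matrix (Fin n) (Fin n) R) {r : Fin n}
    (h : ∀ l, M r l = if r = l then 1 else 0) (c : Fin n) : (M * N) r c = N r c := by
  rw [Matrix.mul_apply]
  simp_rw [h]
  simp [ite_mul]

/-- If column `c` of `N` is the `c`-th unit column then column `c` of `M N` is column `c` of `M`.
[folklore] -/
lemma mul_apply_of_col_eq (M N : Matrix (Fin n) (Fin n) R) {c : Fin n}
    (h : ∀ l, N l c = if l = c then 1 else 0) (r : Fin n) : (M * N) r c = M r c := by
  rw [Matrix.mul_apply]
  simp_rw [h]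
  simp [mul_ite]

/-! #### The column matrices `X_t(x)` and the column group elements `1 + X_t(x)` -/

/-- The nilpotent matrix `X_t(x)` whose only non-zero entries are `x_r` in position `(r, t)`,
`r < t` (column `t`, above the diagonal). [folklore] -/
def colMat (t : Fin n) (x : Fin n → R) : Matrix (Fin n) (Fin n) R :=
  Matrix.of fun r c => if r < t ∧ c = t then x r else 0

/-- Entries of `colMat`. [folklore] -/
@[simp] lemma colMat_apply (t : Fin n) (x : Fin n → R) (r c : Fin n) :
    colMat t x r c = if r < t ∧ c = t then x r else 0 := rfl

/-- `X_t(x) X_t(y) = 0`. [folklore] -/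
lemma colMat_mul_colMat (t : Fin n) (x y : Fin n → R) : colMat t x * colMat t y = 0 := by
  ext r c
  rw [Matrix.mul_apply, Matrix.zero_apply]
  refine Finset.sum_eq_zero fun l _ => ?_
  simp only [colMat_apply]
  by_cases h1 : r < t ∧ l = t
  · by_cases h2 : l < t ∧ c = t
    · exact absurd h2.1 (h1.2 ▸ lt_irrefl t)
    · simp [h2]
  · simp [h1]

/-- `X_t(x + y) = X_t(x) + X_t(y)`. [folklore] -/
lemma colMat_add (t : Fin n) (x y : Fin n → R) : colMat t (x + y) = colMat t x + colMat t y := by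
  ext r c
  simp only [colMat_apply, Matrix.add_apply, Pi.add_apply]
  split_ifs <;> simp

/-- `X_t(0) = 0`. [folklore] -/
@[simp] lemma colMat_zero (t : Fin n) : colMat t (0 : Fin n → R) = 0 := by
  ext r c; simp [colMat_apply]

/-- The **column group element** `c_t(x) = 1 + X_t(x) ∈ GL_n(R)` (the unipotent radical
`V` of the mirabolic in Bernstein–Zelevinsky 1977, §3.1, for the `GL_{t+1}` block), with inverse
`1 - X_t(x)`. [cite: BernsteinZelevinskyASENS1977, §3.1] -/
def colElem (t : Fin n) (x : Fin n → R) : GL (Fin n) R where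
  val := 1 + colMat t x
  inv := 1 - colMat t x
  val_inv := by simp [add_mul, mul_sub, colMat_mul_colMat]
  inv_val := by simp [sub_mul, mul_add, colMat_mul_colMat]

/-- Underlying matrix of `colElem`. [folklore] -/
@[simp] lemma coe_colElem (t : Fin n) (x : Fin n → R) :
    ((colElem t x : GL (Fin n) R) : Matrix (Fin n) (Fin n) R) = 1 + colMat t x := rfl

/-- Underlying matrix of `(colElem t x)⁻¹`. [folklore] -/
@[simp] lemma coe_colElem_inv (t : Fin n) (x : Fin n → R) :
    (((colElem t x)⁻¹ : GL (Fin n) R) : Matrix (Fin n) (Fin n) R) = 1 - colMat t x := rfl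

/-- **Additivity**: `c_t(x + y) = c_t(x) c_t(y)` (the column group is a vector group). [folklore] -/
lemma colElem_add (t : Fin n) (x y : Fin n → R) : colElem t (x + y) = colElem t x * colElem t y := by
  apply Units.ext
  simp only [coe_colElem, Units.val_mul, colMat_add]
  simp [add_mul, mul_add, colMat_mul_colMat]
  abel

/-- `c_t(0) = 1`. [folklore] -/
@[simp] lemma colElem_zero (t : Fin n) : colElem t (0 : Fin n → R) = 1 := by
  apply Units.ext; simp

/-- The column group is commutative. [folklore] -/
lemma colElem_comm (t : Fin n) (x y : Fin n → R) :
    colElem t x * colElem t y = colElem t y * colElem t x := by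
  rw [← colElem_add, ← colElem_add, add_comm]

/-- `c_t(x)⁻¹ = c_t(-x)`. [folklore] -/
lemma colElem_inv (t : Fin n) (x : Fin n → R) : (colElem t x)⁻¹ = colElem t (-x) := by
  symm
  rw [eq_inv_iff_mul_eq_one, ← colElem_add, neg_add_cancel, colElem_zero]

/-- Entries of `c_t(x)`. [folklore] -/
lemma colElem_apply (t : Fin n) (x : Fin n → R) (r c : Fin n) :
    ((colElem t x : GL (Fin n) R) : Matrix (Fin n) (Fin n) R) r c =
      (if r = c then 1 else 0) + (if r < t ∧ c = t then x r else 0) := by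
  simp [Matrix.one_apply]

/-! #### Sets of unipotent matrices described by their support -/

/-- The set `N_{>k}` of unipotent upper triangular matrices whose off-diagonal entries live in
the columns of index `> k` (the unipotent radical of the standard parabolic of type
`(k+1, 1, …, 1)`; for `k = 0` the full group `U_n`, for `k + 1 ≥ n` the trivial group).
[cite: BernsteinZelevinskyASENS1977, §3.1] -/
def tailSet (n : ℕ) (R : Type*) [CommRing R] (k : ℕ) : Set (GL (Fin n) R) :=
  {g | (∀ r, (g : Matrix (Fin n) (Fin n) R) r r = 1) ∧
    ∀ r c : Fin n, r ≠ c → ¬(r < c ∧ k < (c : ℕ)) → (g : Matrix (Fin n) (Fin n) R) r c = 0}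

/-- The set `C_t^{<i}` of column-`t` unipotent matrices `1 + X_t(x)` with `x` supported in the
rows of index `< i` (and `< t`). [cite: BernsteinZelevinskyASENS1977, §3.1] -/
def colPartSet (t : Fin n) (i : ℕ) : Set (GL (Fin n) R) :=
  {g | (∀ r, (g : Matrix (Fin n) (Fin n) R) r r = 1) ∧
    ∀ r c : Fin n, r ≠ c → ¬(c = t ∧ (r : ℕ) < i ∧ r < t) → (g : Matrix (Fin n) (Fin n) R) r c = 0}

/-- `1 ∈ N_{>k}`. [folklore] -/
lemma one_mem_tailSet (k : ℕ) : (1 : GL (Fin n) R) ∈ tailSet n R k :=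
  ⟨fun r => by simp, fun r c hrc _ => by simp [Matrix.one_apply_ne hrc]⟩

/-- `1 ∈ C_t^{<i}`. [folklore] -/
lemma one_mem_colPartSet (t : Fin n) (i : ℕ) : (1 : GL (Fin n) R) ∈ colPartSet (R := R) t i :=
  ⟨fun r => by simp, fun r c hrc _ => by simp [Matrix.one_apply_ne hrc]⟩

/-- For `k + 1 ≥ n` there are no columns of index `> k`: `N_{>k} = {1}`. [folklore] -/
lemma tailSet_eq_singleton {k : ℕ} (hk : n ≤ k + 1) : tailSet n R k = {1} := by
  ext g
  refine ⟨fun hg => ?_, fun hg => by rw [Set.mem_singleton_iff.1 hg]; exact one_mem_tailSet k⟩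
  rw [Set.mem_singleton_iff]
  apply Units.ext
  ext r c
  by_cases hrc : r = c
  · subst hrc; rw [hg.1 r, Units.val_one, Matrix.one_apply_eq]
  · rw [Units.val_one, Matrix.one_apply_ne hrc]
    exact hg.2 r c hrc fun h => by have := c.2; omega

/-- `C_t^{<0} = {1}`. [folklore] -/
lemma colPartSet_zero (t : Fin n) : colPartSet (R := R) t 0 = {1} := by
  ext g
  refine ⟨fun hg => ?_, fun hg => by rw [Set.mem_singleton_iff.1 hg]; exact one_mem_colPartSet t 0⟩
  rw [Set.mem_singleton_iff]
  apply Units.ext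
  ext r c
  by_cases hrc : r = c
  · subst hrc; rw [hg.1 r, Units.val_one, Matrix.one_apply_eq]
  · rw [Units.val_one, Matrix.one_apply_ne hrc]
    exact hg.2 r c hrc fun h => by omega

/-- `c_t(x) ∈ C_t^{<i}` when `x_r = 0` for `i ≤ r < t`. [folklore] -/
lemma colElem_mem_colPartSet (t : Fin n) {i : ℕ} {x : Fin n → R}
    (hx : ∀ r : Fin n, i ≤ (r : ℕ) → r < t → x r = 0) : colElem t x ∈ colPartSet (R := R) t i := by
  refine ⟨fun r => ?_, fun r c hrc h => ?_⟩
  · rw [colElem_apply, if_pos rfl, if_neg, add_zero]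
    rintro ⟨h1, h2⟩
    exact absurd h1 (h2 ▸ lt_irrefl t)
  · rw [colElem_apply, if_neg hrc, zero_add]
    split_ifs with h'
    · apply hx r _ h'.1
      by_contra hlt
      exact h ⟨h'.2, lt_of_not_ge hlt, h'.1⟩
    · rfl

/-- `c_t(x) ∈ C_t^{<t}` for every `x`. [folklore] -/
lemma colElem_mem_colPartSet_self (t : Fin n) (x : Fin n → R) :
    colElem t x ∈ colPartSet (R := R) t t :=
  colElem_mem_colPartSet t fun _ h1 h2 => absurd h2 (not_lt.2 (Fin.le_def.2 h1))

/-- An element of `C_t^{<i}` is `c_t` of its `t`-th column. [folklore] -/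
lemma eq_colElem_of_mem_colPartSet {t : Fin n} {i : ℕ} {g : GL (Fin n) R}
    (hg : g ∈ colPartSet (R := R) t i) :
    g = colElem t fun r => (g : Matrix (Fin n) (Fin n) R) r t := by
  apply Units.ext
  ext r c
  rw [colElem_apply]
  by_cases hrc : r = c
  · subst hrc
    rw [hg.1 r, if_pos rfl, if_neg, add_zero]
    rintro ⟨h1, h2⟩
    exact absurd h1 (h2 ▸ lt_irrefl t)
  · rw [if_neg hrc, zero_add]
    split_ifs with h
    · rw [h.2]
    · apply hg.2 r c hrc
      rintro ⟨h1, -, h3⟩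
      exact h ⟨h3, h1⟩

/-- The `t`-th column of an element of `C_t^{<i}` vanishes in the rows of index `≥ i`
(off the diagonal). [folklore] -/
lemma apply_col_eq_zero_of_mem_colPartSet {t : Fin n} {i : ℕ} {g : GL (Fin n) R}
    (hg : g ∈ colPartSet (R := R) t i) {r : Fin n} (hr : i ≤ (r : ℕ)) (hrt : r ≠ t) :
    (g : Matrix (Fin n) (Fin n) R) r t = 0 :=
  hg.2 r t hrt fun h => absurd h.2.1 (not_lt.2 hr)

/-- **Factorisation inside the column group**: an element of `C_t^{<i+1}` is an element of
`C_t^{<i}` times `c_t(y e_i)` with `y` its `(i, t)` entry. [folklore] -/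
lemma factor_colPartSet_succ {t : Fin n} {i : ℕ} (iF : Fin n) (hiF : (iF : ℕ) = i)
    {g : GL (Fin n) R} (hg : g ∈ colPartSet (R := R) t (i + 1)) :
    ∃ g' ∈ colPartSet (R := R) t i, g = g' * colElem t (Pi.single iF ((g : Matrix _ _ R) iF t)) := by
  set x : Fin n → R := fun r => (g : Matrix (Fin n) (Fin n) R) r t with hx_def
  refine ⟨colElem t (Function.update x iF 0), colElem_mem_colPartSet t fun r hr hrt => ?_, ?_⟩
  · by_cases hri : r = iF
    · subst hri; simp
    · rw [Function.update_of_ne hri, hx_def]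
      by_cases hrt' : r = t
      · exact absurd hrt (hrt' ▸ lt_irrefl t)
      · refine apply_col_eq_zero_of_mem_colPartSet hg ?_ hrt'
        have : (r : ℕ) ≠ i := fun h => hri (Fin.ext (h.trans hiF.symm))
        omega
  · rw [← colElem_add]
    convert eq_colElem_of_mem_colPartSet hg using 2
    ext r
    by_cases hri : r = iF
    · subst hri; simp [hx_def]
    · simp [hri, hx_def]

/-- **Factorisation `N_{≥t} = C_t · N_{>t}`**: for `g ∈ N_{>t-1}` (support in the columns of
index `≥ t`), `c_t(g e_t)⁻¹ g ∈ N_{>t}`. [cite: BernsteinZelevinskyASENS1977, §3.1] -/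
lemma colElem_inv_mul_mem_tailSet {t : Fin n} {g : GL (Fin n) R} (hg : g ∈ tailSet n R ((t : ℕ) - 1)) :
    (colElem t fun r => (g : Matrix (Fin n) (Fin n) R) r t)⁻¹ * g ∈ tailSet n R t := by
  set x : Fin n → R := fun r => (g : Matrix (Fin n) (Fin n) R) r t with hx_def
  -- entries of `(1 - X) g`
  have hXg : ∀ r c, (colMat t x * (g : Matrix (Fin n) (Fin n) R)) r c =
      if r < t then x r * (g : Matrix (Fin n) (Fin n) R) t c else 0 := by
    intro r c
    rw [Matrix.mul_apply]
    by_cases hr : r < t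
    · rw [if_pos hr, Finset.sum_eq_single t]
      · simp [hr]
      · intro l _ hlt; simp [hlt]
      · simp
    · rw [if_neg hr]
      exact Finset.sum_eq_zero fun l _ => by simp [hr]
  have hentry : ∀ r c, (((colElem t x)⁻¹ * g : GL (Fin n) R) : Matrix (Fin n) (Fin n) R) r c =
      (g : Matrix (Fin n) (Fin n) R) r c -
        if r < t then x r * (g : Matrix (Fin n) (Fin n) R) t c else 0 := by
    intro r c
    rw [Units.val_mul, coe_colElem_inv, sub_mul, one_mul, Matrix.sub_apply, hXg]
  -- row `t` of `g`: entries in columns `≤ t` other than the diagonal vanish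
  have hgt : ∀ c : Fin n, c ≠ t → c ≤ t → (g : Matrix (Fin n) (Fin n) R) t c = 0 := fun c hct hle =>
    hg.2 t c (Ne.symm hct) fun h => absurd h.1 (not_lt.2 hle)
  refine ⟨fun r => ?_, fun r c hrc hcond => ?_⟩
  · rw [hentry, hg.1 r]
    by_cases hr : r < t
    · rw [if_pos hr, hgt r hr.ne hr.le, mul_zero, sub_zero]
    · rw [if_neg hr, sub_zero]
  · rw [hentry]
    by_cases hr : r < t
    · rw [if_pos hr]
      by_cases hct : c = t
      · subst hct
        rw [hg.1, mul_one, hx_def, sub_self]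
      · -- `c ≠ t`: either `c < t` or `c > t`; the latter is excluded by `hcond` unless `c < r`
        have hgc : (g : Matrix (Fin n) (Fin n) R) r c = 0 := by
          refine hg.2 r c hrc fun h => hcond ⟨h.1, ?_⟩
          have h2 := h.2
          have : (c : ℕ) ≠ t := fun e => hct (Fin.ext e)
          omega
        have hgtc : (g : Matrix (Fin n) (Fin n) R) t c = 0 := by
          refine hg.2 t c (Ne.symm hct) fun h => hcond ⟨?_, ?_⟩
          · exact hr.trans h.1
          · have := h.1; exact Fin.lt_def.1 this
        rw [hgc, hgtc, mul_zero, sub_zero]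
    · rw [if_neg hr, sub_zero]
      refine hg.2 r c hrc fun h => hcond ⟨h.1, ?_⟩
      have h1 : (t : ℕ) ≤ r := not_lt.1 (fun h' => hr (Fin.lt_def.2 h'))
      have h2 : (r : ℕ) < c := Fin.lt_def.1 h.1
      omega

/-- Row `r ≥ t` of `c_t(x)` is a unit row. [folklore] -/
lemma colElem_row_eq (t : Fin n) (x : Fin n → R) {r : Fin n} (hr : t ≤ r) (l : Fin n) :
    ((colElem t x : GL (Fin n) R) : Matrix (Fin n) (Fin n) R) r l = if r = l then 1 else 0 := by
  have h : ¬(r < t ∧ l = t) := fun h => absurd h.1 (not_lt.2 hr)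
  rw [colElem_apply, if_neg h, add_zero]

/-- Column `t` of an element of `N_{>t}` is a unit column. [folklore] -/
lemma tailSet_col_eq {t : Fin n} {m : GL (Fin n) R} (hm : m ∈ tailSet n R t) (l : Fin n) :
    (m : Matrix (Fin n) (Fin n) R) l t = if l = t then 1 else 0 := by
  by_cases hlt : l = t
  · subst hlt; rw [if_pos rfl, hm.1]
  · rw [if_neg hlt]
    exact hm.2 l t hlt fun h => absurd h.2 (lt_irrefl _)

/-- **Entries of `c_t(x) m`, `m ∈ N_{>t}`**: rows of index `≥ t` are those of `m`, and the
`t`-th column above the diagonal is `x`. [folklore] -/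
lemma colElem_mul_apply_of_le (t : Fin n) (x : Fin n → R) {m : GL (Fin n) R}
    {r : Fin n} (hr : t ≤ r) (c : Fin n) :
    ((colElem t x * m : GL (Fin n) R) : Matrix (Fin n) (Fin n) R) r c =
      (m : Matrix (Fin n) (Fin n) R) r c := by
  rw [Units.val_mul]
  exact mul_apply_of_row_eq _ _ (colElem_row_eq t x hr) c

/-- The `t`-th column of `c_t(x) m`, `m ∈ N_{>t}`, above the diagonal is `x`. [folklore] -/
lemma colElem_mul_apply_col (t : Fin n) (x : Fin n → R) {m : GL (Fin n) R}
    (hm : m ∈ tailSet n R t) {r : Fin n} (hr : r < t) :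
    ((colElem t x * m : GL (Fin n) R) : Matrix (Fin n) (Fin n) R) r t = x r := by
  rw [Units.val_mul, mul_apply_of_col_eq _ _ (tailSet_col_eq hm), colElem_apply, if_neg hr.ne,
    zero_add, if_pos ⟨hr, rfl⟩]

/-! #### Conjugating `N_{>t}` by a root element of the column group -/

/-- For `m ∈ N_{>t}` and `i < t`: `m X_t(y e_i) = X_t(y e_i)` (column `i` of `m` is a unit
column). [folklore] -/
lemma tail_mul_colMat_single {t : Fin n} {m : GL (Fin n) R} (hm : m ∈ tailSet n R t) {i : Fin n}
    (hi : i < t) (y : R) :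
    (m : Matrix (Fin n) (Fin n) R) * colMat t (Pi.single i y) = colMat t (Pi.single i y) := by
  ext r c
  rw [Matrix.mul_apply]
  by_cases hc : c = t
  · subst hc
    rw [Finset.sum_eq_single i]
    · by_cases hri : r = i
      · subst hri; simp [hm.1, hi]
      · have hmi : (m : Matrix (Fin n) (Fin n) R) r i = 0 :=
          hm.2 r i hri fun h => by have := Fin.lt_def.1 hi; have := h.2; omega
        simp [hmi, hri, hi]
    · intro l _ hli
      simp [hli]
    · simp
  · simp [hc]

/-- **Conjugation of `N_{>t}` by a root element `c_t(y e_i)`, `i < t`**: entrywise,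
`c m c⁻¹ = m + y e_i ⊗ (row_t(m) - e_t)`. [folklore] -/
lemma conj_tail_apply {t i : Fin n} (hi : i < t) (y : R) {m : GL (Fin n) R}
    (hm : m ∈ tailSet n R t) (r c : Fin n) :
    ((colElem t (Pi.single i y) * m * (colElem t (Pi.single i y))⁻¹ : GL (Fin n) R) :
        Matrix (Fin n) (Fin n) R) r c =
      (m : Matrix (Fin n) (Fin n) R) r c +
        if r = i then y * ((m : Matrix (Fin n) (Fin n) R) t c - if t = c then 1 else 0) else 0 := by
  set X := colMat t (Pi.single i y : Fin n → R) with hX_def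
  have hmX : (m : Matrix (Fin n) (Fin n) R) * X = X := tail_mul_colMat_single hm hi y
  have hXm : ∀ r c, (X * (m : Matrix (Fin n) (Fin n) R)) r c =
      if r = i then y * (m : Matrix (Fin n) (Fin n) R) t c else 0 := by
    intro r c
    rw [Matrix.mul_apply, Finset.sum_eq_single t]
    · by_cases hri : r = i
      · subst hri; simp [hX_def, hi]
      · simp [hX_def, hri]
    · intro l _ hlt; simp [hX_def, hlt]
    · simp
  have hmat : ((colElem t (Pi.single i y) * m * (colElem t (Pi.single i y))⁻¹ : GL (Fin n) R) :
      Matrix (Fin n) (Fin n) R) = (m : Matrix (Fin n) (Fin n) R) + X * m - X := by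
    rw [Units.val_mul, Units.val_mul, coe_colElem, coe_colElem_inv, ← hX_def]
    have hXmX : X * (m : Matrix (Fin n) (Fin n) R) * X = 0 := by
      rw [Matrix.mul_assoc, hmX, hX_def, colMat_mul_colMat]
    calc (1 + X) * (m : Matrix (Fin n) (Fin n) R) * (1 - X)
        = (m : Matrix (Fin n) (Fin n) R) + X * m - ((m : Matrix (Fin n) (Fin n) R) * X) - X * m * X := by
          noncomm_ring
      _ = (m : Matrix (Fin n) (Fin n) R) + X * m - X := by rw [hmX, hXmX, sub_zero]
  rw [hmat, Matrix.sub_apply, Matrix.add_apply, hXm]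
  by_cases hri : r = i
  · subst hri
    simp only [if_true, hX_def, colMat_apply, hi, true_and]
    by_cases htc : t = c
    · subst htc; simp; ring
    · simp [htc, Ne.symm htc]
  · simp [hri, hX_def]

/-- Conjugating `N_{>t}` by `c_t(y e_i)`, `i < t`, preserves `N_{>t}`. [folklore] -/
lemma conj_tail_mem_tailSet {t i : Fin n} (hi : i < t) (y : R) {m : GL (Fin n) R}
    (hm : m ∈ tailSet n R t) :
    colElem t (Pi.single i y) * m * (colElem t (Pi.single i y))⁻¹ ∈ tailSet n R t := by
  refine ⟨fun r => ?_, fun r c hrc hcond => ?_⟩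
  · rw [conj_tail_apply hi y hm, hm.1]
    by_cases hri : r = i
    · subst hri
      have hti : t ≠ r := fun h => absurd hi (h ▸ lt_irrefl _)
      have : (m : Matrix (Fin n) (Fin n) R) t r = 0 :=
        hm.2 t r hti fun h => absurd (h.1.trans hi) (lt_irrefl _)
      simp [this, hti]
    · simp [hri]
  · rw [conj_tail_apply hi y hm, hm.2 r c hrc hcond, zero_add]
    by_cases hri : r = i
    · subst hri
      rw [if_pos rfl]
      -- `c ≤ t` since `r = i < t` and `¬ (r < c ∧ t < c)`
      have hct : ¬ t < c := fun h => hcond ⟨hi.trans h, Fin.lt_def.1 h⟩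
      by_cases htc : t = c
      · subst htc; rw [hm.1, if_pos rfl, sub_self, mul_zero]
      · rw [if_neg htc, sub_zero, hm.2 t c htc fun h => hct h.1, mul_zero]
    · rw [if_neg hri]

/-- Conjugating `m ∈ N_{>t}` by `c_t(y e_i)`, `i < t`, does not change the rows other than
row `i`; in particular not the rows of index `≥ t`. [folklore] -/
lemma conj_tail_apply_of_ne {t i : Fin n} (hi : i < t) (y : R) {m : GL (Fin n) R}
    (hm : m ∈ tailSet n R t) {r : Fin n} (hr : r ≠ i) (c : Fin n) :
    ((colElem t (Pi.single i y) * m * (colElem t (Pi.single i y))⁻¹ : GL (Fin n) R) :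
        Matrix (Fin n) (Fin n) R) r c = (m : Matrix (Fin n) (Fin n) R) r c := by
  rw [conj_tail_apply hi y hm, if_neg hr, add_zero]

/-- Conjugating `m ∈ N_{>t}` by `c_t(y e_i)` does not change column `t`. [folklore] -/
lemma conj_tail_apply_col {t i : Fin n} (hi : i < t) (y : R) {m : GL (Fin n) R}
    (hm : m ∈ tailSet n R t) (r : Fin n) :
    ((colElem t (Pi.single i y) * m * (colElem t (Pi.single i y))⁻¹ : GL (Fin n) R) :
        Matrix (Fin n) (Fin n) R) r t = (m : Matrix (Fin n) (Fin n) R) r t := by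
  rw [conj_tail_apply hi y hm, hm.1 t]
  simp

/-! #### Block matrices `diag(g₀, 1)` ("top-left" matrices) -/

/-- `M` is a **top-left** matrix of size `t`: it agrees with the identity outside the top-left
`t × t` block, i.e. `M = diag(g₀, 1_{n-t})`. [folklore] -/
def IsTopLeft (t : Fin n) (M : Matrix (Fin n) (Fin n) R) : Prop :=
  ∀ r c : Fin n, (t ≤ r ∨ t ≤ c) → M r c = if r = c then 1 else 0

/-- The identity is top-left. [folklore] -/
lemma isTopLeft_one (t : Fin n) : IsTopLeft t (1 : Matrix (Fin n) (Fin n) R) :=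
  fun r c _ => by rw [Matrix.one_apply]

/-- Products of top-left matrices are top-left. [folklore] -/
lemma IsTopLeft.mul {t : Fin n} {M N : Matrix (Fin n) (Fin n) R} (hM : IsTopLeft t M)
    (hN : IsTopLeft t N) : IsTopLeft t (M * N) := by
  intro r c h
  rcases h with hr | hc
  · rw [mul_apply_of_row_eq M N (fun l => hM r l (Or.inl hr)) c, hN r c (Or.inl hr)]
  · rw [mul_apply_of_col_eq M N (fun l => hN l c (Or.inr hc)) r, hM r c (Or.inr hc)]

/-- The truncation `x̃` of a vector to the rows of index `< t`. [folklore] -/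
def trunc (t : Fin n) (x : Fin n → R) : Fin n → R := fun r => if r < t then x r else 0

/-- Entries of `trunc`. [folklore] -/
@[simp] lemma trunc_apply (t : Fin n) (x : Fin n → R) (r : Fin n) :
    trunc t x r = if r < t then x r else 0 := rfl

/-- `c_t(x)` only depends on `x̃`. [folklore] -/
lemma colElem_trunc (t : Fin n) (x : Fin n → R) : colElem t (trunc t x) = colElem t x := by
  apply Units.ext
  ext r c
  simp only [coe_colElem, Matrix.add_apply, colMat_apply, trunc_apply]
  split_ifs with h1 h2 <;> first | rfl | exact absurd h1.1 h2

/-- **Conjugating the column group by `diag(g₀, 1)`**: `g⁻¹ c_t(x) g = c_t(g₀⁻¹ x̃)` for a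
top-left `g` (with top-left inverse). (Bernstein–Zelevinsky 1977, §3.1: `G_{n-1}` normalises
`V`.) [cite: BernsteinZelevinskyASENS1977, §3.1] -/
lemma topLeft_conj_colElem {t : Fin n} {g : GL (Fin n) R}
    (hg : IsTopLeft t (g : Matrix (Fin n) (Fin n) R))
    (hg' : IsTopLeft t ((g⁻¹ : GL (Fin n) R) : Matrix (Fin n) (Fin n) R)) (x : Fin n → R) :
    g⁻¹ * colElem t x * g =
      colElem t (((g⁻¹ : GL (Fin n) R) : Matrix (Fin n) (Fin n) R) *ᵥ trunc t x) := by
  apply Units.ext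
  set X := colMat t x with hX_def
  set gi : Matrix (Fin n) (Fin n) R := ((g⁻¹ : GL (Fin n) R) : Matrix (Fin n) (Fin n) R) with hgi
  have hXg : X * (g : Matrix (Fin n) (Fin n) R) = X := by
    ext r c
    rw [Matrix.mul_apply, Finset.sum_eq_single t]
    · rw [hg t c (Or.inl le_rfl)]
      by_cases htc : t = c
      · subst htc; simp [hX_def]
      · have hct : c ≠ t := Ne.symm htc
        simp [hX_def, htc, hct]
    · intro l _ hlt; simp [hX_def, hlt]
    · simp
  have hgig : gi * (g : Matrix (Fin n) (Fin n) R) = 1 := by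
    rw [hgi, ← Units.val_mul, inv_mul_cancel, Units.val_one]
  rw [Units.val_mul, Units.val_mul, coe_colElem, coe_colElem, ← hX_def, ← hgi, mul_add, mul_one,
    add_mul, hgig, Matrix.mul_assoc, hXg]
  congr 1
  ext r c
  rw [Matrix.mul_apply, colMat_apply]
  by_cases hct : c = t
  · rw [hct]
    have hX : ∀ l, X l t = if l < t then x l else 0 := fun l => by simp [hX_def]
    simp_rw [hX]
    simp only [and_true, Matrix.mulVec, dotProduct, trunc_apply]
    by_cases hrt : r < t
    · rw [if_pos hrt]
    · rw [if_neg hrt]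
      have hrow : ∀ l, gi r l = if r = l then 1 else 0 := fun l => hg' r l (Or.inl (not_lt.1 hrt))
      simp_rw [hrow]
      refine Finset.sum_eq_zero fun l _ => ?_
      by_cases hl : l < t
      · have : r ≠ l := fun h => hrt (h ▸ hl)
        simp [this]
      · simp [hl]
  · have : ∀ l, X l c = 0 := fun l => by simp [hX_def, hct]
    simp [this, hct]

/-- **Conjugating `N_{>t}` by `diag(g₀, 1)`**, entrywise: `g⁻¹ m g = 1 + g⁻¹ (m - 1)`, and the
rows of index `≥ t` as well as the columns of index `≤ t` are unchanged. [folklore] -/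
lemma topLeft_conj_tail_apply {t : Fin n} {g : GL (Fin n) R}
    (hg : IsTopLeft t (g : Matrix (Fin n) (Fin n) R)) {m : GL (Fin n) R}
    (hm : m ∈ tailSet n R t) (r c : Fin n) :
    ((g⁻¹ * m * g : GL (Fin n) R) : Matrix (Fin n) (Fin n) R) r c =
      (if r = c then 1 else 0) +
        ∑ l, ((g⁻¹ : GL (Fin n) R) : Matrix (Fin n) (Fin n) R) r l *
          ((m : Matrix (Fin n) (Fin n) R) l c - if l = c then 1 else 0) := by
  set N : Matrix (Fin n) (Fin n) R := (m : Matrix (Fin n) (Fin n) R) - 1 with hN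
  set gi : Matrix (Fin n) (Fin n) R := ((g⁻¹ : GL (Fin n) R) : Matrix (Fin n) (Fin n) R) with hgi
  have hNg : N * (g : Matrix (Fin n) (Fin n) R) = N := by
    ext r' c'
    rw [Matrix.mul_apply]
    have : ∀ l, N r' l * (g : Matrix (Fin n) (Fin n) R) l c' = N r' l * if l = c' then 1 else 0 := by
      intro l
      by_cases htl : t < l
      · rw [hg l c' (Or.inl htl.le)]
      · have : N r' l = 0 := by
          simp only [hN, Matrix.sub_apply]
          by_cases hrl : r' = l
          · subst hrl; rw [hm.1, Matrix.one_apply_eq, sub_self]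
          · rw [Matrix.one_apply_ne hrl, sub_zero]
            exact hm.2 r' l hrl fun h => htl (Fin.lt_def.2 h.2)
        rw [this, zero_mul, zero_mul]
    simp_rw [this]
    simp [mul_ite]
  have hgig : gi * (g : Matrix (Fin n) (Fin n) R) = 1 := by
    rw [hgi, ← Units.val_mul, inv_mul_cancel, Units.val_one]
  have hmat : ((g⁻¹ * m * g : GL (Fin n) R) : Matrix (Fin n) (Fin n) R) = 1 + gi * N := by
    have hm' : (m : Matrix (Fin n) (Fin n) R) = 1 + N := by rw [hN]; abel
    rw [Units.val_mul, Units.val_mul, ← hgi, hm', mul_add, mul_one, add_mul, hgig, Matrix.mul_assoc,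
      hNg]
  rw [hmat, Matrix.add_apply, Matrix.one_apply, Matrix.mul_apply]
  simp only [hN, Matrix.sub_apply, Matrix.one_apply]

/-- Conjugating `N_{>t}` by `diag(g₀, 1)` preserves `N_{>t}`. (Bernstein–Zelevinsky 1977,
§3.1.) [cite: BernsteinZelevinskyASENS1977, §3.1] -/
lemma topLeft_conj_tail_mem {t : Fin n} {g : GL (Fin n) R}
    (hg : IsTopLeft t (g : Matrix (Fin n) (Fin n) R))
    (hg' : IsTopLeft t ((g⁻¹ : GL (Fin n) R) : Matrix (Fin n) (Fin n) R)) {m : GL (Fin n) R}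
    (hm : m ∈ tailSet n R t) : g⁻¹ * m * g ∈ tailSet n R t := by
  -- the correction term vanishes in the columns of index `≤ t` and equals `m - 1` in the rows `≥ t`
  have hcol : ∀ r c : Fin n, ¬ t < c →
      ∑ l, ((g⁻¹ : GL (Fin n) R) : Matrix (Fin n) (Fin n) R) r l *
        ((m : Matrix (Fin n) (Fin n) R) l c - if l = c then 1 else 0) = 0 := by
    intro r c hc
    refine Finset.sum_eq_zero fun l _ => ?_
    have : (m : Matrix (Fin n) (Fin n) R) l c - (if l = c then 1 else 0) = 0 := by
      by_cases hlc : l = c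
      · subst hlc; rw [hm.1, if_pos rfl, sub_self]
      · rw [if_neg hlc, sub_zero]; exact hm.2 l c hlc fun h => hc (Fin.lt_def.2 h.2)
    rw [this, mul_zero]
  have hrow : ∀ r c : Fin n, t ≤ r →
      ∑ l, ((g⁻¹ : GL (Fin n) R) : Matrix (Fin n) (Fin n) R) r l *
        ((m : Matrix (Fin n) (Fin n) R) l c - if l = c then 1 else 0) =
        (m : Matrix (Fin n) (Fin n) R) r c - if r = c then 1 else 0 := by
    intro r c hr
    have h1 : ∀ l, ((g⁻¹ : GL (Fin n) R) : Matrix (Fin n) (Fin n) R) r l = if r = l then 1 else 0 :=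
      fun l => hg' r l (Or.inl hr)
    simp_rw [h1]
    simp [ite_mul]
  refine ⟨fun r => ?_, fun r c hrc hcond => ?_⟩
  · rw [topLeft_conj_tail_apply hg hm, if_pos rfl]
    by_cases htr : t < r
    · rw [hrow r r htr.le, hm.1, if_pos rfl, sub_self, add_zero]
    · rw [hcol r r htr, add_zero]
  · rw [topLeft_conj_tail_apply hg hm, if_neg hrc, zero_add]
    by_cases htc : t < c
    · have hcr : c < r := lt_of_le_of_ne (not_lt.1 fun h => hcond ⟨h, Fin.lt_def.1 htc⟩) (Ne.symm hrc)
      rw [hrow r c (htc.trans hcr).le, if_neg hrc, sub_zero]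
      exact hm.2 r c hrc hcond
    · exact hcol r c htc

/-- Conjugating `m ∈ N_{>t}` by `diag(g₀, 1)` does not change the rows of index `≥ t`. [folklore] -/
lemma topLeft_conj_tail_apply_of_le {t : Fin n} {g : GL (Fin n) R}
    (hg : IsTopLeft t (g : Matrix (Fin n) (Fin n) R))
    (hg' : IsTopLeft t ((g⁻¹ : GL (Fin n) R) : Matrix (Fin n) (Fin n) R)) {m : GL (Fin n) R}
    (hm : m ∈ tailSet n R t) {r : Fin n} (hr : t ≤ r) (c : Fin n) :
    ((g⁻¹ * m * g : GL (Fin n) R) : Matrix (Fin n) (Fin n) R) r c =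
      (m : Matrix (Fin n) (Fin n) R) r c := by
  rw [topLeft_conj_tail_apply hg hm]
  have h1 : ∀ l, ((g⁻¹ : GL (Fin n) R) : Matrix (Fin n) (Fin n) R) r l = if r = l then 1 else 0 :=
    fun l => hg' r l (Or.inl hr)
  simp_rw [h1]
  simp [ite_mul]

end Matrices

/-! #### Row shears and a `GL_t`-element with prescribed last row -/

section Shear

variable {K : Type*} [Field K] {n : ℕ}

/-- The rank-one matrix `e_p ⊗ q` (row `p` equal to `q`). [folklore] -/
def rowMat (p : Fin n) (q : Fin n → K) : Matrix (Fin n) (Fin n) K :=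
  Matrix.of fun r c => if r = p then q c else 0

/-- Entries of `rowMat`. [folklore] -/
@[simp] lemma rowMat_apply (p : Fin n) (q : Fin n → K) (r c : Fin n) :
    rowMat p q r c = if r = p then q c else 0 := rfl

/-- `(e_p ⊗ q)(e_p ⊗ q') = q_p (e_p ⊗ q')`. [folklore] -/
lemma rowMat_mul_rowMat (p : Fin n) (q q' : Fin n → K) :
    rowMat p q * rowMat p q' = q p • rowMat p q' := by
  ext r c
  rw [Matrix.mul_apply, Finset.sum_eq_single p]
  · by_cases hr : r = p <;> simp [hr]
  · intro l _ hlp; simp [hlp]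
  · simp

/-- The **row shear** `1 + e_p ⊗ q ∈ GL_n(K)` (row `p` of the identity replaced by
`e_p + q`), invertible when `1 + q_p ≠ 0`, with inverse `1 - (1 + q_p)⁻¹ e_p ⊗ q`
(Sherman–Morrison). [folklore] -/
def rowShear (p : Fin n) (q : Fin n → K) (h : 1 + q p ≠ 0) : GL (Fin n) K where
  val := 1 + rowMat p q
  inv := 1 - (1 + q p)⁻¹ • rowMat p q
  val_inv := by
    rw [add_mul, mul_sub, mul_sub, one_mul, one_mul, mul_one, Matrix.mul_smul, rowMat_mul_rowMat,
      smul_smul]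
    have : (1 + q p)⁻¹ * q p = 1 - (1 + q p)⁻¹ := by field_simp; ring
    rw [this, sub_smul, one_smul]
    abel
  inv_val := by
    rw [sub_mul, mul_add, mul_add, one_mul, one_mul, mul_one, Matrix.smul_mul, rowMat_mul_rowMat,
      smul_smul]
    have : (1 + q p)⁻¹ * q p = 1 - (1 + q p)⁻¹ := by field_simp; ring
    rw [this, sub_smul, one_smul]
    abel

/-- Underlying matrix of `rowShear`. [folklore] -/
@[simp] lemma coe_rowShear (p : Fin n) (q : Fin n → K) (h : 1 + q p ≠ 0) :
    ((rowShear p q h : GL (Fin n) K) : Matrix (Fin n) (Fin n) K) = 1 + rowMat p q := rfl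

/-- Underlying matrix of `(rowShear p q h)⁻¹`. [folklore] -/
@[simp] lemma coe_rowShear_inv (p : Fin n) (q : Fin n → K) (h : 1 + q p ≠ 0) :
    (((rowShear p q h)⁻¹ : GL (Fin n) K) : Matrix (Fin n) (Fin n) K) =
      1 - (1 + q p)⁻¹ • rowMat p q := rfl

/-- A row shear with `p < t` and `q` supported in `< t` is top-left of size `t`, and so is its
inverse. [folklore] -/
lemma isTopLeft_rowShear {t : Fin n} {p : Fin n} (hp : p < t) {q : Fin n → K}
    (hq : ∀ c, t ≤ c → q c = 0) (h : 1 + q p ≠ 0) :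
    IsTopLeft t ((rowShear p q h : GL (Fin n) K) : Matrix (Fin n) (Fin n) K) ∧
      IsTopLeft t (((rowShear p q h)⁻¹ : GL (Fin n) K) : Matrix (Fin n) (Fin n) K) := by
  have key : ∀ r c : Fin n, (t ≤ r ∨ t ≤ c) → (if r = p then q c else 0) = 0 := by
    intro r c hrc
    rcases hrc with hr | hc
    · have hrp : r ≠ p := by
        intro h; rw [h] at hr; exact absurd hp (not_lt.2 hr)
      rw [if_neg hrp]
    · by_cases hrp : r = p
      · rw [if_pos hrp, hq c hc]
      · rw [if_neg hrp]
  constructor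
  · intro r c hrc
    rw [coe_rowShear, Matrix.add_apply, Matrix.one_apply, rowMat_apply, key r c hrc, add_zero]
  · intro r c hrc
    rw [coe_rowShear_inv, Matrix.sub_apply, Matrix.one_apply, Matrix.smul_apply, rowMat_apply,
      key r c hrc, smul_zero, sub_zero]

/-- `v (1 + e_p ⊗ q) = v + v_p q`. [folklore] -/
lemma vecMul_rowShear (v : Fin n → K) (p : Fin n) (q : Fin n → K) (h : 1 + q p ≠ 0) :
    v ᵥ* ((rowShear p q h : GL (Fin n) K) : Matrix (Fin n) (Fin n) K) = v + v p • q := by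
  ext c
  rw [coe_rowShear, Matrix.vecMul_add, Matrix.vecMul_one, Pi.add_apply, Pi.add_apply,
    Pi.smul_apply, smul_eq_mul]
  congr 1
  simp only [Matrix.vecMul, dotProduct, rowMat_apply, mul_ite, mul_zero]
  rw [Finset.sum_ite_eq']
  simp

/-- **A top-left element with prescribed last row**: if `a` is supported in the rows of index
`< t` and is non-zero there, there is `g = diag(g₀, 1)` (`g₀ ∈ GL_t`, with `g⁻¹` of the same
shape) whose row `t - 1` is `a` (transitivity of `GL_t` on non-zero row vectors; the element
of `G_{n-1} ≤ P_n` moving a non-trivial character of `V` to the standard one `θ`,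
Bernstein–Zelevinsky 1977, §3.1, 1976 §5.15). [cite: BernsteinZelevinskyASENS1977, §3.1] -/
theorem exists_topLeft_row_eq {t : Fin n} (tp : Fin n) (htp : (tp : ℕ) + 1 = t) {a : Fin n → K}
    (hat : ∀ r, t ≤ r → a r = 0) (ha : ∃ r, a r ≠ 0) :
    ∃ g : GL (Fin n) K, IsTopLeft t (g : Matrix (Fin n) (Fin n) K) ∧
      IsTopLeft t ((g⁻¹ : GL (Fin n) K) : Matrix (Fin n) (Fin n) K) ∧
      ((Pi.single tp 1 : Fin n → K)) ᵥ* (g : Matrix (Fin n) (Fin n) K) = a := by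
  have htpt : tp < t := Fin.lt_def.2 (by omega)
  by_cases hap : a tp ≠ 0
  · -- Case A: replace row `tp` by `a`
    have h1 : 1 + (a - (Pi.single tp 1 : Fin n → K)) tp ≠ 0 := by simpa using hap
    have hq : ∀ c, t ≤ c → (a - (Pi.single tp 1 : Fin n → K)) c = 0 := fun c hc => by
      have : c ≠ tp := by rintro rfl; exact absurd htpt (not_lt.2 hc)
      simp [hat c hc, this]
    refine ⟨rowShear tp (a - (Pi.single tp 1 : Fin n → K)) h1, (isTopLeft_rowShear htpt hq h1).1,
      (isTopLeft_rowShear htpt hq h1).2, ?_⟩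
    rw [vecMul_rowShear]; simp
  · -- Case B: `a_{tp} = 0`; first create a non-zero entry at `tp` with an upper shear
    push Not at hap
    obtain ⟨r₀, hr₀⟩ := ha
    have hr₀t : r₀ < t := lt_of_not_ge fun h => hr₀ (hat r₀ h)
    have hr₀tp : r₀ ≠ tp := by rintro rfl; exact hr₀ hap
    let q₂ : Fin n → K := -(a r₀)⁻¹ • (Pi.single tp 1 : Fin n → K)
    have h2 : 1 + q₂ r₀ ≠ 0 := by simp [q₂, hr₀tp]
    have h1 : 1 + a tp ≠ 0 := by rw [hap, add_zero]; exact one_ne_zero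
    have hq₂ : ∀ c, t ≤ c → q₂ c = 0 := fun c hc => by
      have : c ≠ tp := by rintro rfl; exact absurd htpt (not_lt.2 hc)
      simp [q₂, this]
    obtain ⟨hA, hA'⟩ := isTopLeft_rowShear htpt hat h1
    obtain ⟨hB, hB'⟩ := isTopLeft_rowShear hr₀t hq₂ h2
    refine ⟨rowShear tp a h1 * rowShear r₀ q₂ h2, ?_, ?_, ?_⟩
    · rw [Units.val_mul]; exact hA.mul hB
    · rw [_root_.mul_inv_rev, Units.val_mul]; exact hB'.mul hA'
    · rw [Units.val_mul, ← Matrix.vecMul_vecMul, vecMul_rowShear, vecMul_rowShear]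
      have e1 : (Pi.single tp 1 : Fin n → K) + (Pi.single tp 1 : Fin n → K) tp • a = Pi.single tp 1 + a := by simp
      have e2 : ((Pi.single tp 1 : Fin n → K) + a) r₀ = a r₀ := by simp [hr₀tp]
      have e3 : a r₀ • q₂ = -(Pi.single tp 1 : Fin n → K) := by
        simp only [q₂, smul_smul, smul_neg, neg_smul]
        rw [mul_inv_cancel₀ hr₀, one_smul]
      rw [e1, e2, e3]
      abel

end Shear

end WhittakerSupercuspidal

end Literature.NumberTheory.Automorphic

/-! ### Twisted coinvariant kernels for a subset and a character -/

namespace Representation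

section TwistedKer

variable {k G V : Type*} [CommRing k] [Group G] [AddCommGroup V] [Module k V]
  (ρ : Representation k G V)

/-- The kernel `V(H, χ) = ⟨ρ(h) v - χ(h) v : h ∈ H, v ∈ V⟩` of the projection onto the
`(H, χ)`-**twisted coinvariants** `V / V(H, χ)` (`r_{H,χ}` of Bernstein–Zelevinsky 1977, §1.8;
Bump 1997, §4.4, `V_{N,ψ}`), for an arbitrary subset `H` of `G` and an arbitrary function
`χ : G → k` (a character of a subgroup in applications). Deliberate dot-notation extension of
Mathlib's `Representation` namespace. [cite: BernsteinZelevinskyASENS1977, §1.8] -/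
def twistedKer (H : Set G) (χ : G → k) : Submodule k V :=
  Submodule.span k {w | ∃ g ∈ H, ∃ v : V, w = ρ g v - χ g • v}

variable {ρ}

/-- Generators of `twistedKer`. [folklore] -/
lemma sub_smul_mem_twistedKer {H : Set G} {χ : G → k} {g : G} (hg : g ∈ H) (v : V) :
    ρ g v - χ g • v ∈ ρ.twistedKer H χ :=
  Submodule.subset_span ⟨g, hg, v, rfl⟩

/-- **Monotonicity**: `V(H, χ) ≤ V(H', χ')` if `H ⊆ H'` and `χ = χ'` on `H`. [folklore] -/
lemma twistedKer_mono {H H' : Set G} {χ χ' : G → k} (hH : H ⊆ H') (hχ : ∀ g ∈ H, χ g = χ' g) :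
    ρ.twistedKer H χ ≤ ρ.twistedKer H' χ' := by
  refine Submodule.span_le.2 ?_
  rintro _ ⟨g, hg, v, rfl⟩
  rw [hχ g hg]
  exact sub_smul_mem_twistedKer (hH hg) v

/-- `V({1}, χ) = 0` if `χ 1 = 1`. [folklore] -/
lemma twistedKer_singleton_one {χ : G → k} (hχ : χ 1 = 1) : ρ.twistedKer {1} χ = ⊥ := by
  rw [twistedKer, Submodule.span_eq_bot]
  rintro _ ⟨g, hg, v, rfl⟩
  rw [Set.mem_singleton_iff.1 hg, hχ, map_one, one_smul, Module.End.one_apply, sub_self]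

/-- **Coinvariants in stages**: if every element of `K` is a product `h h'` (`h ∈ H`, `h' ∈ H'`)
and `χ` is multiplicative on such products, then `V(K, χ) ≤ V(H, χ) + V(H', χ)`:
`ρ(hh')v - χ(hh')v = (ρ(h)w - χ(h)w) + χ(h)(ρ(h')v - χ(h')v)` with `w = ρ(h')v`. [folklore] -/
lemma twistedKer_le_sup_of_mul {K H H' : Set G} {χ : G → k}
    (hK : ∀ g ∈ K, ∃ h ∈ H, ∃ h' ∈ H', g = h * h')
    (hχ : ∀ h ∈ H, ∀ h' ∈ H', χ (h * h') = χ h * χ h') :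
    ρ.twistedKer K χ ≤ ρ.twistedKer H χ ⊔ ρ.twistedKer H' χ := by
  refine Submodule.span_le.2 ?_
  rintro _ ⟨g, hg, v, rfl⟩
  obtain ⟨h, hh, h', hh', rfl⟩ := hK g hg
  have : ρ (h * h') v - χ (h * h') • v =
      (ρ h (ρ h' v) - χ h • ρ h' v) + χ h • (ρ h' v - χ h' • v) := by
    rw [map_mul, Module.End.mul_apply, hχ h hh h' hh', smul_sub, smul_smul]
    abel
  rw [SetLike.mem_coe, this]
  exact Submodule.add_mem _ (Submodule.mem_sup_left (sub_smul_mem_twistedKer hh _))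
    (Submodule.mem_sup_right (Submodule.smul_mem _ _ (sub_smul_mem_twistedKer hh' v)))

/-- **Transport of structure**: `ρ(g₀) V(H, χ) ≤ V(H', χ')` whenever `g₀ H g₀⁻¹ ⊆ H'` and
`χ'(g₀ h g₀⁻¹) = χ(h)` (Bump 1997, §4.4, before Prop. 4.4.1: `π(t)(π(u)v - v) = π(u')v' - v'`,
`u' = t u t⁻¹`, `v' = π(t) v`). [cite: Bump1997, §4.4 (PDF p. 460)] -/
lemma map_twistedKer_le {H H' : Set G} {χ χ' : G → k} (g₀ : G)
    (h : ∀ x ∈ H, g₀ * x * g₀⁻¹ ∈ H' ∧ χ' (g₀ * x * g₀⁻¹) = χ x) :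
    (ρ.twistedKer H χ).map (ρ g₀) ≤ ρ.twistedKer H' χ' := by
  rw [twistedKer, Submodule.map_span_le]
  rintro _ ⟨x, hx, v, rfl⟩
  obtain ⟨hmem, hχ⟩ := h x hx
  have : ρ g₀ (ρ x v - χ x • v) = ρ (g₀ * x * g₀⁻¹) (ρ g₀ v) - χ' (g₀ * x * g₀⁻¹) • ρ g₀ v := by
    rw [hχ, map_sub, map_smul, ← Module.End.mul_apply, ← map_mul, ← Module.End.mul_apply,
      ← map_mul, inv_mul_cancel_right]
  rw [this]
  exact sub_smul_mem_twistedKer hmem _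

/-- If a surjective linear map sends `S'` into `S ≠ ⊤` then `S' ≠ ⊤`. [folklore] -/
lemma _root_.Submodule.ne_top_of_map_le {R M : Type*} [Semiring R] [AddCommMonoid M] [Module R M]
    {S S' : Submodule R M} (f : M →ₗ[R] M) (hf : Function.Surjective f) (h : S'.map f ≤ S)
    (hS : S ≠ ⊤) : S' ≠ ⊤ := by
  rintro rfl
  rw [Submodule.map_top, LinearMap.range_eq_top.2 hf, top_le_iff] at h
  exact hS h

end TwistedKer

section CoinvariantsGL

open Literature.NumberTheory.Automorphic

variable {k : Type*} [CommRing k] (R : Type*) [CommRing R] {n : Type*} [Fintype n]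
  [DecidableEq n] {α : Type*} [LinearOrder α] (c : n → α)
  {V : Type*} [AddCommGroup V] [Module k V]

/-- The kernel of `π ↦ r_c π` (Mathlib `Representation.Coinvariants.ker` of
`restrictUnipotentGL R c π`) is contained in — in fact equal to — the twisted kernel
`V(U_c, 1)`. [folklore] -/
lemma coinvariantsKer_restrictUnipotentGL_le (π : Representation k (GL n R) V) :
    Coinvariants.ker (restrictUnipotentGL R c π) ≤
      π.twistedKer (unipotentRadicalGL R c) (fun _ => 1) := by
  rw [Coinvariants.ker, Submodule.span_le]
  rintro _ ⟨⟨g, v⟩, rfl⟩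
  have hmem : ((g : standardParabolicGL R c) : GL n R) ∈ unipotentRadicalGL R c :=
    Subgroup.mem_map.2 ⟨(g : standardParabolicGL R c), g.2, rfl⟩
  have := sub_smul_mem_twistedKer (ρ := π) (χ := fun _ => (1 : k)) hmem v
  rw [one_smul] at this
  exact this

end CoinvariantsGL

end Representation

namespace Literature.NumberTheory.Automorphic

namespace WhittakerSupercuspidal

open Representation TwistedJacquet

/-! ### The characters `Θ_B(g) = ψ(∑ B_{rc} g_{rc})` -/

section Characters

variable {F : Type*} [Field F] (ψ : AddChar F Circle) {n : ℕ}

/-- The function `Θ_B : GL_n(F) → ℂ`, `g ↦ ψ(∑_{r,c} B_{rc} g_{rc})`, attached to a weight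
matrix `B`; on a subgroup of unipotent matrices on which the weighted entry sum is additive it
is a character (e.g. `ψ_N(u) = ψ(∑ u_{i,i+1})`, Bump 1997, §4.4, PDF p. 455; the characters
`θ` of Bernstein–Zelevinsky 1977, §3.1). [cite: Bump1997, §4.4 (PDF p. 455)] -/
noncomputable def charOf (B : Matrix (Fin n) (Fin n) F) (g : GL (Fin n) F) : ℂ :=
  ((ψ (∑ r, ∑ c, B r c * (g : Matrix (Fin n) (Fin n) F) r c) : Circle) : ℂ)

/-- `Θ_B(g) = Θ_{B'}(g')` when the weighted entries agree termwise. [folklore] -/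
lemma charOf_congr {B B' : Matrix (Fin n) (Fin n) F} {g g' : GL (Fin n) F}
    (h : ∀ r c, B r c * (g : Matrix (Fin n) (Fin n) F) r c =
      B' r c * (g' : Matrix (Fin n) (Fin n) F) r c) :
    charOf ψ B g = charOf ψ B' g' := by
  unfold charOf
  congr 2
  exact Finset.sum_congr rfl fun r _ => Finset.sum_congr rfl fun c _ => h r c

/-- `Θ_B` is multiplicative on a product whose weighted entries add up. [folklore] -/
lemma charOf_eq_mul_of_add {B : Matrix (Fin n) (Fin n) F} {g h gh : GL (Fin n) F}
    (hadd : ∀ r c, B r c * (gh : Matrix (Fin n) (Fin n) F) r c =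
      B r c * (g : Matrix (Fin n) (Fin n) F) r c + B r c * (h : Matrix (Fin n) (Fin n) F) r c) :
    charOf ψ B gh = charOf ψ B g * charOf ψ B h := by
  unfold charOf
  rw [← Circle.coe_mul, ← AddChar.map_add_eq_mul]
  congr 2
  rw [← Finset.sum_add_distrib]
  refine Finset.sum_congr rfl fun r _ => ?_
  rw [← Finset.sum_add_distrib]
  exact Finset.sum_congr rfl fun c _ => hadd r c

/-- `Θ_B(g) = 1` when all weighted entries vanish. [folklore] -/
lemma charOf_eq_one {B : Matrix (Fin n) (Fin n) F} {g : GL (Fin n) F}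
    (h : ∀ r c, B r c * (g : Matrix (Fin n) (Fin n) F) r c = 0) : charOf ψ B g = 1 := by
  unfold charOf
  rw [Finset.sum_eq_zero fun r _ => Finset.sum_eq_zero fun c _ => h r c, AddChar.map_zero_eq_one,
    Circle.coe_one]

/-- The **tail weight** `T_k`: `(T_k)_{r, r+1} = 1` for `r ≥ k`, `0` elsewhere, so that
`Θ_{T_k}(g) = ψ(∑_{r ≥ k} g_{r,r+1})` (the generic character of `N_{>k}`; for `k = 0` the
standard `ψ_N`). [cite: Bump1997, §4.4 (PDF p. 455)] -/
def tailWt (n : ℕ) (F : Type*) [Field F] (k : ℕ) : Matrix (Fin n) (Fin n) F :=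
  Matrix.of fun r c => if k ≤ (r : ℕ) ∧ (c : ℕ) = (r : ℕ) + 1 then 1 else 0

/-- Entries of `tailWt`. [folklore] -/
@[simp] lemma tailWt_apply (k : ℕ) (r c : Fin n) :
    tailWt n F k r c = if k ≤ (r : ℕ) ∧ (c : ℕ) = (r : ℕ) + 1 then 1 else 0 := rfl

/-- The tail weight vanishes in the rows of index `< k` and on the diagonal. [folklore] -/
lemma tailWt_apply_of_lt {k : ℕ} {r : Fin n} (hr : (r : ℕ) < k) (c : Fin n) : tailWt n F k r c = 0 := by
  rw [tailWt_apply, if_neg]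
  rintro ⟨h, -⟩
  omega

/-- The tail weight vanishes on the diagonal. [folklore] -/
lemma tailWt_apply_diag (k : ℕ) (r : Fin n) : tailWt n F k r r = 0 := by
  rw [tailWt_apply, if_neg]
  rintro ⟨-, h⟩
  omega

/-- `Θ_{T_k}(1) = 1`, and more generally `Θ_{X_t(a) + T_t}(1) = 1`. [folklore] -/
lemma charOf_colMat_add_tailWt_one (t : Fin n) (a : Fin n → F) :
    charOf ψ (colMat t a + tailWt n F t) 1 = 1 := by
  refine charOf_eq_one ψ fun r c => ?_
  rw [Units.val_one]
  by_cases hrc : r = c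
  · subst hrc
    rw [Matrix.add_apply, tailWt_apply_diag, add_zero, colMat_apply, if_neg, zero_mul]
    rintro ⟨h1, h2⟩; exact absurd h1 (h2 ▸ lt_irrefl _)
  · rw [Matrix.one_apply_ne hrc, mul_zero]

/-- `Θ_{T_k}(1) = 1`. [folklore] -/
lemma charOf_tailWt_one (k : ℕ) : charOf ψ (tailWt n F k) (1 : GL (Fin n) F) = 1 := by
  refine charOf_eq_one ψ fun r c => ?_
  rw [Units.val_one]
  by_cases hrc : r = c
  · subst hrc; rw [tailWt_apply_diag, zero_mul]
  · rw [Matrix.one_apply_ne hrc, mul_zero]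

/-- On `N_{>t}` the column part of the weight is invisible: `Θ_{X_t(a)+T_t} = Θ_{T_t}`. [folklore] -/
lemma charOf_colMat_add_tailWt_of_mem_tailSet (t : Fin n) (a : Fin n → F) {m : GL (Fin n) F}
    (hm : m ∈ tailSet n F t) : charOf ψ (colMat t a + tailWt n F t) m = charOf ψ (tailWt n F t) m := by
  refine charOf_congr ψ fun r c => ?_
  rw [Matrix.add_apply, add_mul, add_eq_right, colMat_apply]
  split_ifs with h
  · rw [h.2, tailSet_col_eq hm r, if_neg h.1.ne, mul_zero]
  · rw [zero_mul]

/-- A finite sum over `c` of a term supported at `c = t`. [folklore] -/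
lemma sum_ite_and_eq (P : Prop) [Decidable P] (t : Fin n) (x : F) :
    (∑ c : Fin n, if P ∧ c = t then x else 0) = if P then x else 0 := by
  by_cases hP : P
  · simp [hP]
  · simp [hP]

/-- **The character on the column group**: `Θ_{X_t(a)+T_t}(c_t(x)) = ψ(∑_{r<t} a_r x_r)`. [folklore] -/
lemma charOf_colElem (t : Fin n) (a x : Fin n → F) :
    charOf ψ (colMat t a + tailWt n F t) (colElem t x) = ψ (∑ r, if r < t then a r * x r else 0) := by
  unfold charOf
  congr 2
  refine Finset.sum_congr rfl fun r _ => ?_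
  rw [← sum_ite_and_eq (r < t) t (a r * x r)]
  refine Finset.sum_congr rfl fun c _ => ?_
  rw [colElem_apply, Matrix.add_apply, tailWt_apply, colMat_apply]
  by_cases h : r < t ∧ c = t
  · have hrt := h.1
    have hne : r ≠ c := fun e => by rw [e, h.2] at hrt; exact lt_irrefl _ hrt
    have hnot : ¬((t : ℕ) ≤ r ∧ (c : ℕ) = r + 1) := fun h' =>
      absurd (Fin.lt_def.1 hrt) (not_lt.2 h'.1)
    rw [if_pos h, if_pos h, if_pos h, if_neg hnot, if_neg hne, add_zero, zero_add]
  · rw [if_neg h, if_neg h, zero_add, add_zero]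
    split_ifs with h1 h2
    · exfalso; rcases h2 with rfl; omega
    · rw [mul_zero]
    · rw [zero_mul]
    · rw [zero_mul]

/-- **Multiplicativity across `C_t · N_{>t}`**: `Θ(c_t(x) m) = Θ(c_t(x)) Θ(m)` for `m ∈ N_{>t}`
and `Θ = Θ_{X_t(a)+T_t}` (the weighted entries of the product are the sums of those of the
factors). [folklore] -/
lemma charOf_colElem_mul_tail (t : Fin n) (a x : Fin n → F) {m : GL (Fin n) F}
    (hm : m ∈ tailSet n F t) :
    charOf ψ (colMat t a + tailWt n F t) (colElem t x * m) =
      charOf ψ (colMat t a + tailWt n F t) (colElem t x) * charOf ψ (colMat t a + tailWt n F t) m := by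
  refine charOf_eq_mul_of_add ψ fun r c => ?_
  rw [← mul_add]
  by_cases hr : t ≤ r
  · rw [colElem_mul_apply_of_le t x hr, colElem_row_eq t x hr]
    by_cases hrc : r = c
    · subst hrc
      rw [Matrix.add_apply, tailWt_apply_diag, add_zero, colMat_apply, if_neg, zero_mul, zero_mul]
      exact fun h => absurd h.1 (not_lt.2 hr)
    · rw [if_neg hrc, zero_add]
  · have hrt : r < t := lt_of_not_ge hr
    rw [Matrix.add_apply, tailWt_apply_of_lt (Fin.lt_def.1 hrt), add_zero, colMat_apply]
    by_cases hct : c = t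
    · subst hct
      rw [if_pos ⟨hrt, rfl⟩, colElem_mul_apply_col c x hm hrt, colElem_apply, if_neg hrt.ne,
        zero_add, if_pos ⟨hrt, rfl⟩, tailSet_col_eq hm, if_neg hrt.ne, add_zero]
    · rw [if_neg (fun h => hct h.2), zero_mul, zero_mul]

/-- **Shifting the standard character by one column**: `T_{t-1} = T_t + X_t(e_{t-1})`. [folklore] -/
lemma tailWt_pred (t tp : Fin n) (htp : (tp : ℕ) + 1 = t) :
    tailWt n F ((t : ℕ) - 1) = colMat t (Pi.single tp 1) + tailWt n F t := by
  ext r c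
  simp only [tailWt_apply, Matrix.add_apply, colMat_apply, Pi.single_apply, Fin.ext_iff, Fin.lt_def]
  split_ifs <;> (try simp) <;> omega

/-- `N_{>0} = U_n`: the upper unitriangular group lies in (indeed equals) `tailSet n F 0`. [folklore] -/
lemma mem_tailSet_zero_of_mem_upperUnitriangular {u : GL (Fin n) F}
    (hu : u ∈ upperUnitriangular (Fin n) F) : u ∈ tailSet n F 0 := by
  rw [mem_upperUnitriangular_iff] at hu
  refine ⟨hu.2, fun r c hrc h => hu.1 ?_⟩
  change c < r
  rcases lt_or_gt_of_ne hrc with h' | h'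
  · exact absurd ⟨h', by have := Fin.lt_def.1 h'; omega⟩ h
  · exact h'

/-- **The standard generic character is `Θ_{T_0}`**: `ψ_U(u) = Θ_{T_0}(u)` on `U_n`. [folklore] -/
lemma whittakerCharFun_eq_charOf (u : ↥(upperUnitriangular (Fin n) F)) :
    whittakerCharFun ψ u = charOf ψ (tailWt n F 0) (u : GL (Fin n) F) := by
  rw [whittakerCharFun_apply, superdiagSum_def, charOf]
  congr 2
  refine Finset.sum_congr rfl fun r _ => Finset.sum_congr rfl fun c _ => ?_
  rw [tailWt_apply]
  simp only [zero_le, true_and, ite_mul, one_mul, zero_mul]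
  by_cases h : (r : ℕ) + 1 = c
  · rw [if_pos h, if_pos h.symm]
  · rw [if_neg h, if_neg (fun h' => h h'.symm)]

end Characters

/-! ### The two-block unipotent radicals `U_{(t, n-t)}` -/

section TwoBlock

variable {F : Type*} [Field F] {n : ℕ}

/-- The block labelling of the maximal standard parabolic of type `(t, n - t)`. [folklore] -/
def twoBlock (t : Fin n) : Fin n → Fin 2 := fun i => if i < t then 0 else 1

/-- Unfolding lemma for `twoBlock`. [folklore] -/
lemma twoBlock_apply (t i : Fin n) : twoBlock t i = if i < t then 0 else 1 := rfl

/-- `twoBlock t` is monotone. [folklore] -/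
lemma twoBlock_monotone (t : Fin n) : Monotone (twoBlock t) := by
  intro i j hij
  simp only [twoBlock_apply]
  by_cases h1 : i < t
  · rw [if_pos h1]; exact Fin.zero_le _
  · have h2 : ¬ j < t := fun h => h1 (lt_of_le_of_lt hij h)
    rw [if_neg h1, if_neg h2]

/-- For `1 ≤ t` (and `t < n`), `twoBlock t` defines a proper parabolic. [folklore] -/
lemma isProperBlocks_twoBlock (t : Fin n) (ht : 1 ≤ (t : ℕ)) : IsProperBlocks (twoBlock t) := by
  rw [isProperBlocks_iff_two_le]
  refine ⟨fun b => ?_, le_rfl⟩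
  have hn : 0 < n := lt_of_le_of_lt (Nat.zero_le _) t.2
  fin_cases b
  · refine ⟨⟨0, hn⟩, ?_⟩
    simp only [twoBlock_apply]
    rw [if_pos (Fin.lt_def.2 (by simp; omega))]
    rfl
  · refine ⟨⟨n - 1, by omega⟩, ?_⟩
    simp only [twoBlock_apply]
    rw [if_neg (fun h => by have := Fin.lt_def.1 h; simp at this; omega)]
    rfl

/-- **Entries of `U_{(t,n-t)}`**: an element of the unipotent radical of the two-block parabolic
has identity entries except in the block `rows < t, columns ≥ t`. [folklore] -/
lemma apply_of_mem_unipotentRadicalGL_twoBlock {t : Fin n} {g : GL (Fin n) F}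
    (hg : g ∈ unipotentRadicalGL F (twoBlock t)) (r c : Fin n) (h : ¬(r < t ∧ t ≤ c)) :
    (g : Matrix (Fin n) (Fin n) F) r c = if r = c then 1 else 0 := by
  rw [mem_unipotentRadicalGL_iff] at hg
  obtain ⟨hbt, hsq⟩ := hg
  by_cases hblock : twoBlock t r = twoBlock t c
  · -- same block: read off the square block
    have := congrFun (congrFun (hsq (twoBlock t r)) ⟨r, rfl⟩) ⟨c, hblock.symm⟩
    rw [Matrix.toSquareBlock_def] at this
    simp only [Matrix.of_apply] at this
    rw [this]
    by_cases hrc : r = c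
    · subst hrc; simp
    · rw [Matrix.one_apply_ne, if_neg hrc]
      exact fun h' => hrc (congrArg Subtype.val h')
  · -- different blocks: `c` is in block 0 and `r` in block 1 (the other case is excluded by `h`)
    have hrc : r ≠ c := fun e => hblock (e ▸ rfl)
    rw [if_neg hrc]
    apply hbt
    simp only [twoBlock_apply] at hblock ⊢
    by_cases hr : r < t
    · by_cases hc : c < t
      · rw [if_pos hr, if_pos hc] at hblock; exact absurd rfl hblock
      · exact absurd ⟨hr, not_lt.1 hc⟩ h
    · by_cases hc : c < t
      · rw [if_neg hr, if_pos hc]; exact Fin.zero_lt_one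
      · rw [if_neg hr, if_neg hc] at hblock; exact absurd rfl hblock

/-- `U_{(t,n-t)} ⊆ N_{>t-1}` (support in the columns of index `≥ t`). [folklore] -/
lemma mem_tailSet_of_mem_unipotentRadicalGL_twoBlock {t : Fin n} {g : GL (Fin n) F}
    (hg : g ∈ unipotentRadicalGL F (twoBlock t)) : g ∈ tailSet n F ((t : ℕ) - 1) := by
  refine ⟨fun r => ?_, fun r c hrc h => ?_⟩
  · rw [apply_of_mem_unipotentRadicalGL_twoBlock hg r r fun h => absurd (lt_of_lt_of_le h.1 h.2)
      (lt_irrefl _), if_pos rfl]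
  · rw [apply_of_mem_unipotentRadicalGL_twoBlock hg r c, if_neg hrc]
    rintro ⟨h1, h2⟩
    refine h ⟨lt_of_lt_of_le h1 h2, ?_⟩
    have := Fin.le_def.1 h2
    have := Fin.lt_def.1 h1
    omega

end TwoBlock

/-! ### The kernels `W_k` and `S_{t,i,a}` -/

section Kernels

variable {F : Type*} [Field F] {n : ℕ} {V : Type*} [AddCommGroup V] [Module ℂ V]
  (π : Representation ℂ (GL (Fin n) F) V) (ψ : AddChar F Circle)

/-- The kernel `W_k = V(N_{>k}, Θ_{T_k})` of the projection onto `(Φ⁻)^{n-1-k}(π)`, the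
`(n-1-k)`-fold Bernstein–Zelevinsky functor `Φ⁻ = r_{V,θ}` applied to `π|_{P_n}`
(Bernstein–Zelevinsky 1977, §3.2, §3.5). [cite: BernsteinZelevinskyASENS1977, §3.5] -/
noncomputable def derivKer (k : ℕ) : Submodule ℂ V :=
  π.twistedKer (tailSet n F k) (charOf ψ (tailWt n F k))

/-- The intermediate kernels `S_{t,i,a} = V(C_t^{<i}, Θ_{X_t(a)+T_t}) + W_t` of the coordinate-
by-coordinate descent inside the column `t`. [folklore] -/
noncomputable def stepKer (t : Fin n) (i : ℕ) (a : Fin n → F) : Submodule ℂ V :=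
  π.twistedKer (colPartSet t i) (charOf ψ (colMat t a + tailWt n F t)) ⊔ derivKer π ψ t

variable {π ψ}

/-- Base of the induction: `W_k = 0` when there is no column of index `> k`. [folklore] -/
lemma derivKer_eq_bot {k : ℕ} (hk : n ≤ k + 1) : derivKer π ψ k = ⊥ := by
  rw [derivKer, tailSet_eq_singleton hk]
  exact twistedKer_singleton_one (charOf_tailWt_one ψ k)

/-- `S_{t,0,a} = W_t`. [folklore] -/
lemma stepKer_zero (t : Fin n) (a : Fin n → F) : stepKer π ψ t 0 a = derivKer π ψ t := by
  rw [stepKer, colPartSet_zero, twistedKer_singleton_one (charOf_colMat_add_tailWt_one ψ t a),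
    bot_sup_eq]

/-- **Splitting off the column**: `V(N_{>t-1}, Θ_{X_t(a)+T_t}) ≤ V(C_t, Θ) + W_t`
(factorisation `N_{≥ t} = C_t ⋉ N_{>t}` and multiplicativity of `Θ` across it; this is
`r_{N_{≥t},Θ} = r_{V,θ} ∘ r_{N_{>t},…}`, coinvariants in stages, Bernstein–Zelevinsky 1977,
§3.2). [cite: BernsteinZelevinskyASENS1977, §3.2] -/
lemma twistedKer_tailSet_pred_le (t : Fin n) (a : Fin n → F) :
    π.twistedKer (tailSet n F ((t : ℕ) - 1)) (charOf ψ (colMat t a + tailWt n F t)) ≤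
      stepKer π ψ t t a := by
  refine (twistedKer_le_sup_of_mul (H := colPartSet t t) (H' := tailSet n F t) ?_ ?_).trans ?_
  · intro g hg
    exact ⟨_, colElem_mem_colPartSet_self t _, _, colElem_inv_mul_mem_tailSet hg,
      (mul_inv_cancel_left _ _).symm⟩
  · intro h hh h' hh'
    rw [eq_colElem_of_mem_colPartSet hh]
    exact charOf_colElem_mul_tail ψ t a _ hh'
  · refine sup_le_sup_left ?_ _
    exact twistedKer_mono subset_rfl fun m hm => charOf_colMat_add_tailWt_of_mem_tailSet ψ t a hm

/-- The character `Θ_{X_t(a)+T_t}` on `C_t` only sees `a_r`, `r < t`: replacing `a` by its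
truncation does not change `S_{t,i,a}`. [folklore] -/
lemma stepKer_trunc (t : Fin n) (i : ℕ) (a : Fin n → F) :
    stepKer π ψ t i (trunc t a) = stepKer π ψ t i a := by
  have key : ∀ g ∈ colPartSet (R := F) t i, charOf ψ (colMat t (trunc t a) + tailWt n F t) g =
      charOf ψ (colMat t a + tailWt n F t) g := by
    intro g hg
    rw [eq_colElem_of_mem_colPartSet hg, charOf_colElem, charOf_colElem]
    congr 2
    refine Finset.sum_congr rfl fun r _ => ?_
    by_cases hr : r < t <;> simp [hr]
  rw [stepKer, stepKer]
  congr 1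
  exact le_antisymm (twistedKer_mono subset_rfl key) (twistedKer_mono subset_rfl fun g hg => (key g hg).symm)

/-- An irreducible representation lives on a non-trivial space. [folklore] -/
lemma nontrivial_of_isIrreducible [π.IsIrreducible] : Nontrivial V := by
  by_contra hV
  rw [not_nontrivial_iff_subsingleton] at hV
  have : (⊥ : Subrepresentation π) = ⊤ :=
    Subrepresentation.toSubmodule_injective (Subsingleton.elim _ _)
  exact (IsSimpleOrder.bot_ne_top (α := Subrepresentation π)) this

end Kernels

/-! ### The inductive argument -/

section Main

universe u

variable {F : Type u} [Field F] [ValuativeRel F] [TopologicalSpace F] [IsNonarchimedeanLocalField F]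
  {n : ℕ} {V : Type*} [AddCommGroup V] [Module ℂ V]
  {π : Representation ℂ (GL (Fin n) F) V} {ψ : AddChar F Circle}

/-- The root subgroup `x ↦ c_t(x e_i)` is continuous. [folklore] -/
lemma continuous_colElem_single (t i : Fin n) :
    Continuous fun x : F => (colElem t (Pi.single i x) : GL (Fin n) F) := by
  have hmat : Continuous fun x : F => colMat t (Pi.single i x : Fin n → F) := by
    refine continuous_matrix fun r c => ?_
    simp only [colMat_apply, Pi.single_apply]
    split_ifs <;> first | exact continuous_id | exact continuous_const
  refine Units.continuous_iff.2 ⟨?_, ?_⟩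
  · change Continuous fun x : F => ((colElem t (Pi.single i x) : GL (Fin n) F) : Matrix (Fin n) (Fin n) F)
    simp only [coe_colElem]
    exact continuous_const.add hmat
  · change Continuous fun x : F =>
      (((colElem t (Pi.single i x))⁻¹ : GL (Fin n) F) : Matrix (Fin n) (Fin n) F)
    simp only [coe_colElem_inv]
    exact continuous_const.sub hmat

/-- **Smoothness along a root subgroup**: every vector of a smooth representation is fixed by
`c_t(x e_i)` for `x` in a lattice. [folklore] -/
lemma exists_ball_forall_colElem_apply_eq (hπ : π.IsSmooth) (t i : Fin n) (v : V) :
    ∃ s : F, s ≠ 0 ∧ ∀ x ∈ ball s, π (colElem t (Pi.single i x)) v = v := by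
  have hopen : IsOpen ((fun x : F => (colElem t (Pi.single i x) : GL (Fin n) F)) ⁻¹'
      (π.stabilizerSubgroup v : Set (GL (Fin n) F))) :=
    (hπ v).preimage (continuous_colElem_single t i)
  have h0 : (0 : F) ∈ (fun x : F => (colElem t (Pi.single i x) : GL (Fin n) F)) ⁻¹'
      (π.stabilizerSubgroup v : Set (GL (Fin n) F)) := by
    simp
  obtain ⟨s, hs, hsub⟩ := exists_ball_subset_of_mem_nhds (hopen.mem_nhds h0)
  exact ⟨s, hs, fun x hx => (π.mem_stabilizerSubgroup v _).1 (hsub hx)⟩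

/-- **One coordinate of the descent** (the rank-one non-vanishing lemma
`TwistedJacquet.exists_sup_twistedSpan_ne_top` applied to the root subgroup `c_t(· e_i)` acting
on `V / S_{t,i,a}`): if `S_{t,i,a} ≠ V` and `i < t` then `S_{t,i+1,a'} ≠ V` for some `a'`
differing from `a` only in the `i`-th coordinate. [cite: BernsteinZelevinskyASENS1977, §3.2 Proposition (e) and Remark 3.3 (b)] -/
lemma exists_stepKer_succ_ne_top (hπ : π.IsSmooth) (hψ : ψ.IsContinuousNontrivial) (t : Fin n)
    {i : ℕ} (iF : Fin n) (hiF : (iF : ℕ) = i) (hit : iF < t) {a : Fin n → F}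
    (ha : stepKer π ψ t i a ≠ ⊤) : ∃ b : F, stepKer π ψ t (i + 1) (Function.update a iF b) ≠ ⊤ := by
  -- the one-parameter subgroup
  let e : F → GL (Fin n) F := fun x => colElem t (Pi.single iF x)
  have he : ∀ x y, e (x + y) = e x * e y := fun x y => by
    simp only [e, Pi.single_add, colElem_add]
  have hsm : ∀ v : V, ∃ s : F, s ≠ 0 ∧ ∀ x ∈ ball s, π (e x) v = v :=
    fun v => exists_ball_forall_colElem_apply_eq hπ t iF v
  -- `S_{t,i,a}` is stable under the root subgroup
  have hW : ∀ x : F, stepKer π ψ t i a ≤ (stepKer π ψ t i a).comap (π (e x)) := by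
    intro x
    rw [← Submodule.map_le_iff_le_comap, stepKer, Submodule.map_sup]
    refine sup_le_sup ?_ ?_
    · refine map_twistedKer_le (e x) fun c hc => ?_
      have hcomm : e x * c * (e x)⁻¹ = c := by
        rw [eq_colElem_of_mem_colPartSet hc, colElem_comm, mul_inv_cancel_right]
      rw [hcomm]
      exact ⟨hc, rfl⟩
    · refine map_twistedKer_le (e x) fun m hm => ⟨conj_tail_mem_tailSet hit x hm, ?_⟩
      refine charOf_congr ψ fun r c => ?_
      by_cases hr : (r : ℕ) < t
      · rw [tailWt_apply_of_lt hr, zero_mul, zero_mul]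
      · rw [conj_tail_apply_of_ne hit x hm]
        rintro rfl
        exact hr (Fin.lt_def.1 hit)
  obtain ⟨b, hb⟩ := exists_sup_twistedSpan_ne_top (ρ := π) (e := e) (ψ := ψ) he hsm hψ hW ha
  refine ⟨b, fun htop => hb (top_le_iff.1 (htop.symm.le.trans ?_))⟩
  -- `S_{t,i+1,a'} ≤ S_{t,i,a} + V(e, ψ_b)`
  set a' := Function.update a iF b with ha'
  have hχcol : ∀ y : Fin n → F, charOf ψ (colMat t a' + tailWt n F t) (colElem t y) =
      ψ (∑ r, if r < t then a' r * y r else 0) := fun y => charOf_colElem ψ t a' y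
  rw [stepKer]
  refine sup_le ?_ (le_sup_left.trans' le_sup_right)
  refine (twistedKer_le_sup_of_mul (H := colPartSet t i) (H' := Set.range e) ?_ ?_).trans
    (sup_le_sup ?_ ?_)
  · intro g hg
    obtain ⟨g', hg', hgeq⟩ := factor_colPartSet_succ iF hiF hg
    exact ⟨g', hg', _, ⟨_, rfl⟩, hgeq⟩
  · rintro h hh _ ⟨y, rfl⟩
    rw [eq_colElem_of_mem_colPartSet hh]
    simp only [e]
    rw [← colElem_add, hχcol, hχcol, hχcol, ← Circle.coe_mul, ← AddChar.map_add_eq_mul,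
      ← Finset.sum_add_distrib]
    congr 2
    refine Finset.sum_congr rfl fun r _ => ?_
    split_ifs <;> simp [mul_add]
  · -- on `C_t^{<i}` the new character agrees with the old one
    refine (twistedKer_mono subset_rfl fun g hg => ?_).trans le_sup_left
    rw [eq_colElem_of_mem_colPartSet hg, charOf_colElem, charOf_colElem]
    congr 2
    refine Finset.sum_congr rfl fun r _ => ?_
    by_cases hr : r < t
    · rw [if_pos hr, if_pos hr]
      by_cases hri : r = iF
      · subst hri
        rw [apply_col_eq_zero_of_mem_colPartSet hg (le_of_eq hiF.symm) hr.ne, mul_zero, mul_zero]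
      · rw [ha', Function.update_of_ne hri]
    · rw [if_neg hr, if_neg hr]
  · -- on the root subgroup the new character is `ψ_b`
    refine Submodule.span_le.2 ?_
    rintro _ ⟨_, ⟨y, rfl⟩, v, rfl⟩
    have : charOf ψ (colMat t a' + tailWt n F t) (e y) = ψ (b * y) := by
      simp only [e]
      rw [hχcol]
      congr 1
      rw [Finset.sum_eq_single iF]
      · rw [if_pos hit, ha', Function.update_self, Pi.single_eq_same]
      · intro r _ hri
        rw [Pi.single_eq_of_ne hri, mul_zero, ite_self]
      · simp
    rw [this]
    exact TwistedJacquet.sub_smul_mem_twistedSpan π e ψ b y v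

/-- **The coordinate descent through the column `t`**: if `W_t ≠ V` then `S_{t,t,a} ≠ V` for
some `a` supported in the rows of index `< t`. [folklore] -/
lemma exists_stepKer_self_ne_top (hπ : π.IsSmooth) (hψ : ψ.IsContinuousNontrivial) (t : Fin n)
    (hW : derivKer π ψ t ≠ ⊤) :
    ∃ a : Fin n → F, (∀ r, t ≤ r → a r = 0) ∧ stepKer π ψ t t a ≠ ⊤ := by
  have key : ∀ i : ℕ, i ≤ (t : ℕ) → ∃ a : Fin n → F, stepKer π ψ t i a ≠ ⊤ := by
    intro i
    induction i with
    | zero => exact fun _ => ⟨0, by rwa [stepKer_zero]⟩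
    | succ i ih =>
      intro hi
      obtain ⟨a, ha⟩ := ih (Nat.le_of_succ_le hi)
      have hin : i < n := lt_of_lt_of_le (Nat.lt_of_succ_le hi) t.2.le
      obtain ⟨b, hb⟩ := exists_stepKer_succ_ne_top hπ hψ t ⟨i, hin⟩ rfl
        (Fin.lt_def.2 (Nat.lt_of_succ_le hi)) ha
      exact ⟨_, hb⟩
  obtain ⟨a, ha⟩ := key t le_rfl
  refine ⟨trunc t a, fun r hr => ?_, by rwa [stepKer_trunc]⟩
  rw [trunc_apply, if_neg (not_lt.2 hr)]

/-- **The step `W_t ≠ V ⟹ W_{t-1} ≠ V`** (`1 ≤ t ≤ n - 1`), given the vanishing of the Jacquet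
module of the maximal parabolic of type `(t, n-t)` (in the form `V(U_{(t,n-t)}, 1) = V`): the
coordinate descent produces `a ≠ 0` (the case `a = 0` would give `V(U_{(t,n-t)},1) ≤ S_{t,t,0} ≠ V`),
an element `g = diag(g₀, 1)` with `e_{t-1} g₀ = a` conjugates `Θ_{X_t(a)+T_t}` into the
standard `Θ_{T_{t-1}} = Θ_{X_t(e_{t-1})+T_t}`, and `W_{t-1} ≤ V(C_t, Θ_{T_{t-1}}) + W_t`.
(Bernstein–Zelevinsky 1977, §3.5 with Theorem 4.4 (Gelfand–Kazhdan): for quasicuspidal `π`,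
`π^{(k)} = 0` for `0 < k < n`, hence `(Φ⁻)^{k}(π) ≠ 0` for all `k < n`.) [cite: BernsteinZelevinskyASENS1977, Theorem 4.4] -/
theorem derivKer_pred_ne_top (hπ : π.IsSmooth) (hψ : ψ.IsContinuousNontrivial) (t : Fin n)
    (ht : 1 ≤ (t : ℕ))
    (hjac : π.twistedKer (unipotentRadicalGL F (twoBlock t)) (fun _ => 1) = ⊤)
    (hW : derivKer π ψ t ≠ ⊤) : derivKer π ψ ((t : ℕ) - 1) ≠ ⊤ := by
  obtain ⟨a, hat, ha⟩ := exists_stepKer_self_ne_top hπ hψ t hW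
  -- `a ≠ 0`
  have ha0 : ∃ r, a r ≠ 0 := by
    by_contra h
    push Not at h
    have h0 : a = 0 := funext h
    apply ha
    rw [h0, eq_top_iff, ← hjac]
    refine (twistedKer_mono (fun g hg => mem_tailSet_of_mem_unipotentRadicalGL_twoBlock hg)
      fun g hg => ?_).trans (twistedKer_tailSet_pred_le t 0)
    symm
    refine charOf_eq_one ψ fun r c => ?_
    rw [Matrix.add_apply, colMat_zero, Matrix.zero_apply, zero_add]
    by_cases hr : (r : ℕ) < t
    · rw [tailWt_apply_of_lt hr, zero_mul]
    · rw [apply_of_mem_unipotentRadicalGL_twoBlock hg r c fun h => hr (Fin.lt_def.1 h.1)]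
      by_cases hrc : r = c
      · subst hrc; rw [tailWt_apply_diag, zero_mul]
      · rw [if_neg hrc, mul_zero]
  -- the conjugating element
  have htn : (t : ℕ) - 1 < n := lt_of_le_of_lt (Nat.sub_le _ _) t.2
  set tp : Fin n := ⟨(t : ℕ) - 1, htn⟩ with htp_def
  have htp : (tp : ℕ) + 1 = t := by simp [htp_def]; omega
  have htpt : tp < t := Fin.lt_def.2 (by omega)
  obtain ⟨g, hg, hg', hrow⟩ := exists_topLeft_row_eq tp htp hat ha0
  -- the standard kernel `S_std = V(C_t, Θ_{T_{t-1}}) + W_t` and its transport into `S_{t,t,a}`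
  have hstd : stepKer π ψ t t (Pi.single tp 1) ≠ ⊤ := by
    refine Submodule.ne_top_of_map_le (π g⁻¹) ?_ ?_ ha
    · intro v
      exact ⟨π g v, by rw [← Module.End.mul_apply, ← map_mul, inv_mul_cancel, map_one,
        Module.End.one_apply]⟩
    rw [stepKer, stepKer, Submodule.map_sup]
    refine sup_le_sup ?_ ?_
    · refine map_twistedKer_le (g⁻¹) fun c hc => ?_
      rw [inv_inv, eq_colElem_of_mem_colPartSet hc, topLeft_conj_colElem hg hg']
      refine ⟨colElem_mem_colPartSet_self t _, ?_⟩
      rw [charOf_colElem, charOf_colElem]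
      congr 1
      set y : Fin n → F := fun r => ((c : GL (Fin n) F) : Matrix (Fin n) (Fin n) F) r t with hy
      -- `∑_{r<t} a_r (g⁻¹ ỹ)_r = a ⬝ (g⁻¹ ỹ) = (a g⁻¹) ⬝ ỹ = e_{tp} ⬝ ỹ = y_{tp}`
      have h1 : (∑ r, if r < t then a r * (((g⁻¹ : GL (Fin n) F) : Matrix (Fin n) (Fin n) F) *ᵥ
          trunc t y) r else 0) = a ⬝ᵥ (((g⁻¹ : GL (Fin n) F) : Matrix (Fin n) (Fin n) F) *ᵥ trunc t y) := by
        refine Finset.sum_congr rfl fun r _ => ?_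
        by_cases hr : r < t
        · rw [if_pos hr]
        · rw [if_neg hr, hat r (not_lt.1 hr), zero_mul]
      have h2 : a ⬝ᵥ (((g⁻¹ : GL (Fin n) F) : Matrix (Fin n) (Fin n) F) *ᵥ trunc t y) = y tp := by
        rw [Matrix.dotProduct_mulVec, ← hrow, Matrix.vecMul_vecMul, ← Units.val_mul,
          mul_inv_cancel, Units.val_one, Matrix.vecMul_one, single_dotProduct, one_mul, trunc_apply,
          if_pos htpt]
      have h3 : (∑ r, if r < t then (Pi.single tp (1 : F) : Fin n → F) r * y r else 0) = y tp := by
        rw [Finset.sum_eq_single tp]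
        · rw [if_pos htpt, Pi.single_eq_same, one_mul]
        · intro r _ hr; rw [Pi.single_eq_of_ne hr, zero_mul, ite_self]
        · simp
      rw [h1, h2, h3]
    · refine map_twistedKer_le (g⁻¹) fun m hm => ?_
      rw [inv_inv]
      refine ⟨topLeft_conj_tail_mem hg hg' hm, charOf_congr ψ fun r c => ?_⟩
      by_cases hr : (r : ℕ) < t
      · rw [tailWt_apply_of_lt hr, zero_mul, zero_mul]
      · rw [topLeft_conj_tail_apply_of_le hg hg' hm (not_lt.1 fun h => hr (Fin.lt_def.1 h))]
  -- `W_{t-1} ≤ S_std`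
  refine fun htop => hstd (top_le_iff.1 (htop.symm.le.trans ?_))
  rw [derivKer, tailWt_pred t tp htp]
  exact twistedKer_tailSet_pred_le t _

/-- **All the kernels `W_k` are proper** for an irreducible smooth supercuspidal `π`
(downward induction on `k` from `W_k = 0` for `k ≥ n - 1`), granted Harish-Chandra's
criterion `isSupercuspidal_iff_jacquetGL`. In Bernstein–Zelevinsky's language:
`(Φ⁻)^{j}(π|_P) ≠ 0` for all `j ≤ n - 1`. [cite: BernsteinZelevinskyASENS1977, Theorem 4.4] -/
theorem derivKer_ne_top [π.IsIrreducible] (hπ : π.IsSmooth) (hsc : π.IsSupercuspidal)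
    (hψ : ψ.IsContinuousNontrivial) (h1 : isSupercuspidal_iff_jacquetGL (n := n) (V := V) F)
    (k : ℕ) : derivKer π ψ k ≠ ⊤ := by
  haveI : Nontrivial V := nontrivial_of_isIrreducible (π := π)
  have hjac : ∀ t : Fin n, 1 ≤ (t : ℕ) →
      π.twistedKer (unipotentRadicalGL F (twoBlock t)) (fun _ => 1) = ⊤ := by
    intro t ht
    have hsub := (h1 π hπ).1 hsc 2 (twoBlock t) (isProperBlocks_twoBlock t ht) (twoBlock_monotone t)
    have hsub' : Subsingleton (V ⧸ Coinvariants.ker (restrictUnipotentGL F (twoBlock t) π)) := hsub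
    have hker : Coinvariants.ker (restrictUnipotentGL F (twoBlock t) π) = ⊤ :=
      Submodule.Quotient.subsingleton_iff.1 hsub'
    exact eq_top_iff.2 (hker.symm.le.trans (coinvariantsKer_restrictUnipotentGL_le F (twoBlock t) π))
  suffices ∀ j k : ℕ, n ≤ k + 1 + j → derivKer π ψ k ≠ ⊤ from this n k (by omega)
  intro j
  induction j with
  | zero =>
    intro k hk
    rw [derivKer_eq_bot (by omega)]
    exact bot_ne_top
  | succ j ih =>
    intro k hk
    by_cases hk' : n ≤ k + 1
    · rw [derivKer_eq_bot hk']
      exact bot_ne_top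
    · have hkn : k + 1 < n := lt_of_not_ge hk'
      have := derivKer_pred_ne_top hπ hψ ⟨k + 1, hkn⟩ (Nat.le_add_left 1 k)
        (hjac _ (Nat.le_add_left 1 k)) (ih (k + 1) (by omega))
      simpa using this

end Main

end WhittakerSupercuspidal

/-! ### Supercuspidal representations are generic -/

section Generic

universe u

variable {F : Type u} [Field F] [ValuativeRel F] [TopologicalSpace F] [IsNonarchimedeanLocalField F]
  {n : ℕ} {V : Type*} [AddCommGroup V] [Module ℂ V]
  (π : Representation ℂ (GL (Fin n) F) V) (ψ : AddChar F Circle)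

open WhittakerSupercuspidal Representation

/-- **Supercuspidal representations of `GL_n(F)` are generic, granted Harish-Chandra's
criterion** (Gelfand–Kazhdan 1975, Thm. 8; Bernstein–Zelevinsky 1977, Theorem 4.4 with §3.5:
for an irreducible cuspidal `π`, `π^{(k)} = 0` for `0 < k < n` and so the highest derivative
`π^{(n)} = r_{U,ψ_U}(π)` is non-zero, i.e. `π` admits a non-zero Whittaker functional): the
named fact `isGeneric_of_isSupercuspidal π ψ` follows from the named fact
`isSupercuspidal_iff_jacquetGL F` (Harish-Chandra: matrix coefficients compactly supported
modulo the centre iff all proper Jacquet modules vanish), of which only the forward direction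
for the maximal parabolics `P_{(t, n-t)}` is used. The Whittaker functional is any non-zero
linear form vanishing on the proper subspace `W_0 = V(U_n, ψ_U)`. [cite: BernsteinZelevinskyASENS1977, Theorem 4.4] -/
theorem isGeneric_of_isSupercuspidal_of_jacquet
    (h1 : isSupercuspidal_iff_jacquetGL (n := n) (V := V) F) : isGeneric_of_isSupercuspidal π ψ := by
  intro _ hπ hsc hψ
  have hW : derivKer π ψ 0 ≠ ⊤ := derivKer_ne_top hπ hsc hψ h1 0
  obtain ⟨Λ, hΛ0, hΛ⟩ := Submodule.exists_dual_map_eq_bot_of_lt_top hW.lt_top inferInstance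
  rw [isGeneric_iff]
  refine ⟨Λ, (mem_whittakerFunctionals_iff Λ).2 fun u v => ?_, hΛ0⟩
  have hmem : π (u : GL (Fin n) F) v - charOf ψ (tailWt n F 0) (u : GL (Fin n) F) • v ∈ derivKer π ψ 0 :=
    sub_smul_mem_twistedKer (mem_tailSet_zero_of_mem_upperUnitriangular u.2) v
  have hzero : Λ (π (u : GL (Fin n) F) v - charOf ψ (tailWt n F 0) (u : GL (Fin n) F) • v) = 0 := by
    have := Submodule.mem_map_of_mem (f := Λ) hmem
    rw [hΛ, Submodule.mem_bot] at this
    exact this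
  rw [map_sub, map_smul, smul_eq_mul, sub_eq_zero] at hzero
  rw [hzero, whittakerCharFun_eq_charOf]

end Generic

end Literature.NumberTheory.Automorphic
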